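import Summits.AnomalousDissipation.AnomalousDissipation.Theses.MomentParity
import Summits.AnomalousDissipation.AnomalousDissipation.Theorems.MomentParityResolvedDissipationTrajectoryUI
import Summits.AnomalousDissipation.AnomalousDissipation.Theorems.MomentParityResolvedDissipationTrajectoryUILocalWindow
import Summits.AnomalousDissipation.AnomalousDissipation.Theorems.MomentParityFamilyOfOrbits
import Summits.AnomalousDissipation.AnomalousDissipation.Theorems.MomentParityResolvedDissipationStubEnergyPassage
import Summits.AnomalousDissipation.AnomalousDissipation.Theorems.MomentParityResolvedDissipationStubInitialStrong
import Summits.AnomalousDissipation.AnomalousDissipation.Theorems.MomentParityResolvedDissipationStubBoundedOrders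
import Summits.AnomalousDissipation.AnomalousDissipation.Theorems.MomentParityResolvedDissipationStubVitaliUI
import Summits.AnomalousDissipation.AnomalousDissipation.Theorems.MomentParityResolvedDissipationStubPathwiseFGT
import Summits.AnomalousDissipation.AnomalousDissipation.Theorems.MomentParityResolvedDissipationStubLowModePassage
import Summits.AnomalousDissipation.AnomalousDissipation.Theorems.MomentParityResolvedDissipationStubRestart
import Summits.AnomalousDissipation.AnomalousDissipation.Theorems.MomentParityResolvedDissipationStubTrajectoryUIOfGalerkinEEae
import Summits.AnomalousDissipation.AnomalousDissipation.Theorems.MomentParityResolvedDissipationStubGalerkinEEaeOfTrajectoryUI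
import Summits.AnomalousDissipation.AnomalousDissipation.Theorems.MomentParityResolvedDissipationStubResolvedOfSSSEnergyEq
import Literature.Analysis.FluidPDE.NSGalerkinFamilyWeakForm
import Literature.Analysis.FluidPDE.NSGalerkinFamilyEnergy
import Literature.Analysis.FluidPDE.OnsagerCCFSEnergyProofs
import Summits.AnomalousDissipation.AnomalousDissipation.Theses.Correlation
import Summits.AnomalousDissipation.AnomalousDissipation.Theorems.MomentParityGalerkinEnsembleRealizationStubTimeAverages
import Summits.AnomalousDissipation.AnomalousDissipation.Theorems.MomentParityResolvedDissipationOfNoMeanLeakage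

/-!
# Line `enstrophy-ui-transfer` for crux `MomentParity.ResolvedDissipation` (stmt-AnomalousDissipation-14284)
# — skeleton v12 (lead c10, 2026-08-17): RESHAPED — the composition now runs through an EXISTING ledger item (S17–S19 LANDED p159669/p160579):
# `ResolvedDissipation_of := stub_resolvedOfNoMeanLeakage stub_noMeanLeakage` with S16 `stub_noMeanLeakage` =
# `Correlation.NoMeanLeakage` (stmt-AnomalousDissipation-14265, open crux of routes Correlation / CriticalLayer) and the
# NEW bridge S17 `NoMeanLeakage ⟹ RD` proved by this lead via S18/S19 (ergodic Vishik–Fursikov lift); S1 (TUI) kept as the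
# alternative conjecture-grade leaf (its composition is the `example` at the end; v10 of lead c8 otherwise unchanged)

v2 (lead 0): ONE sorry, U `stub_uniformIntegrability` (N-uniform UI of the enstrophy over all admissible laws),
certified crux-EQUIVALENT (Converse p85945 / Reduction p90097). v3/v4 (lead c4) keeps `UI ⟹ RD` (the landed
Reduction) and DECOMPOSES U DYNAMICALLY: by invariance of admissible laws under the Galerkin semiflow
`E_μ[Z; Z > M] = T⁻¹ E_μ ∫₀ᵀ (Z·1{Z>M})(S_t u) dt`; on data of enstrophy `≤ G` the time integral is the subject of the
hard stub S1 (finite-dimensional, finite-time, measure-free); on data of enstrophy `> G` (mass `≤ ‖f‖R/(νG)`) the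
pathwise energy identity bounds `ν∫₀ᵀ Z(S_t a) dt ≤ ‖a‖² + T‖f‖²/(4π²ν)`.

* S1 `stub_trajectoryUI` (HARD, conjecture-grade): N-uniform time-integrability of the enstrophy along Galerkin
  trajectories from `V`-bounded zero-mean data in the `L²`-ball over ONE fixed window.
* S2a `stub_zeroMean_galerkinFlow` p139620 · S2 `stub_pathwiseDissipation` p139973 · S3 `stub_invarianceAveraging`
  p139785 · S4 `stub_levelCoeff` p139584 · glue + compositions p140175 (`TrajectoryUI.*`) — all LANDED (lead c4).
* `ResolvedDissipation_of` := Reduction ∘ glue ∘ S1 (concludes the crux BY NAME; ONE sorry in its cone: S1).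

v5 (lead c5) — the ANATOMY of S1, landed `--supports` stmt-14284: `TrajectoryUIAnatomy` p141066 (the data-enstrophy
bound `Z(a) ≤ G` is load-bearing: S1 without it is FALSE at f = 0), `TrajectoryUILocalWindow` p141524 (S1 with `∀ G ∃ T`
is a THEOREM, N-uniformly: Leray's local propagation `Z ≤ 2G+1` on `[0, T(G)]`), `SuperLerayWindow` p141981 (SLW ⟹ RD).

v6/v7 (lead c6) — S1 ORDERED UNDER LHEE: the calibration stubs S6 `stub_vitaliUI` (p143417), S7 `stub_boundedOrders`
(p143377), S8 `stub_initialStrong` (p143361), S9 `stub_energyPassage` (p143328) and the lead's assembly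
`trajectoryUIAt_of_lerayHopfEnergyEquality` (landed as `Theorems/MomentParityResolvedDissipationTrajectoryUIOfLHEE.lean`,
p144419) prove **LHEE ⟹ TUI** (and, with the energy equality assumed only for GALERKIN LIMITS — the weaker leaf GEE —
**GEE ⟹ TUI ⟹ RD**, tools stub `stub_trajectoryUIOfGalerkinEE`, `Theorems/…TrajectoryUIOfGalerkinEE.lean` p145184): the conjecture-grade stub S5 of line `lh-energy-equality-bracket` (Leray–Hopf energy
equality between positive times, hypothesis verbatim as in `LhBracket.resolvedAt_of_lerayHopfEnergyEquality`) implies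
S1, by Vitali along a violating sequence (Hopf–Galerkin FAMILY of the violators, `exists_limitField`, strong times
`exists_strictMono_ae_tendsto_eLpNorm`, Rellich at `t = 0` (S8), `isGlobalLerayHopf_limit`, LHEE on `[s₁, s₂]`, energy
passage (S9), uniform integrability (S6), local bound (c5) on `(0, s₁]`, bounded orders excluded (S7)). The map is now
a CHAIN of tree theorems: LHEE ⟹ GEE ⟹ TUI ⟹ U ⟺ RD (and LHEE ⟹ RD directly, c3 p137959); leaves LHEE ≥ GEE ≥ TUI conjecture-grade
(open: fixed-ν energy equality / no time-concentration for Galerkin limits). This line is COMPLETE MODULO S1; outcome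
for the planners: the crux is an open problem; file GEE (energy equality for Fourier–Galerkin limits of forced NS on T³;
weaker and more credible than LHEE) or LHEE as the ONE conjecture item — TUI and RD follow in tree either way.

v8 (lead c7) — THE LEAF MADE CANONICAL: stubs S10 `stub_pathwiseFGT` (N-uniform pathwise Foias–Guillopé–Temam bound
along Galerkin orbits), S11 `stub_lowModePassage`, S12 `stub_restart`, S13 `stub_trajectoryUIOfGalerkinEEae` (GEE₀ᵃᵉ ⟹ TUI,
c6's assembly under the a.e./mean-zero leaf) and the lead's S14 `stub_galerkinEEaeOfTrajectoryUI` (TUI ⟹ GEE₀ᵃᵉ: no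
time-concentration by S1 + no wavenumber escape at bounded levels by S10 ⟹ the dissipation integrals of a Hopf–Galerkin
family converge ⟹ energy equality of the limit between a.e. pairs of positive times). ALL LANDED (S10 p148927, S11 p148587, S12 p148957, S13 p149679, Lemma A/B/C p151234, S14 p151586; corollary
`TrajectoryUIIffGalerkinEEae.trajectoryUI_iff_galerkinEEae` / `resolvedDissipation_of_galerkinEEae`): GEE ⟹ GEE₀ᵃᵉ ⟺ TUI ⟹ U ⟺ RD,
every arrow a tree theorem; the ONE conjecture-grade leaf is S1 = TUI = GEE₀ᵃᵉ.

v11 (lead c10) — THE LEAF BECOMES AN EXISTING ITEM. `Correlation.NoMeanLeakage` (NML, stmt-AnomalousDissipation-14265: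
for every ν > 0, smooth div-free mean-zero steady f and EVERY global Leray–Hopf solution, ⟨(f,u)⟩ ≤ ν⟨‖∇u‖²⟩ as limsups of
running means) implies the crux: ¬RD ⟹ leaking sequence ⟹ shift-invariant limit law `Q` on 𝒦 with a work–dissipation
margin (landed S1/S2 of line `lh-energy-equality-bracket`) ⟹ S19 `stub_genericLeakingPoint` (Birkhoff's pointwise ergodic
theorem, tree `birkhoff_ergodic_theorem_holds`, for the work functional and the FULL dissipation functional: a `Q`-generic
support point with νG* < W*) ⟹ realisation by a global Leray–Hopf solution (landed `stub_supportApprox`, `stub_realisation`)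
⟹ S18 `stub_meansOfRealisation` (its long-time means: `longTimeAvgSup (f,u) = W* > νG* ≥ meanDissipation ν u`) — a
Leray–Hopf solution LEAKING IN THE MEAN, contradicting NML. LHEE ⟹ NML (telescoping), so the bracket is refined to
LHEE ⟹ NML ⟹ RD with NML WEAKER than LHEE and an EXISTING multi-route item. Stubs: S16 `stub_noMeanLeakage` (= stmt-14265,
conjecture-grade, the crux's `blocked-on`), S17 `stub_resolvedOfNoMeanLeakage` + S19 (Theorems file
`MomentParityResolvedDissipationOfNoMeanLeakage`, LANDED p160579), S18 (Theorems file `MomentParityResolvedDissipationNoMeanLeakagePrep`,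
LANDED p159669). v12: the three sorries replaced by the landed names; ONE sorry in the cone of `ResolvedDissipation_of`: S16 (the item).

Disproof.lean (§0–§7, tree 2026-08-16T07:27Z, unchanged, no `-- Targets`) honoured: `0 < ν` is used in S2 and
the budget; stationarity (all degrees) enters only through invariance (S3); the level clause enters S4; §6 is the
Markov input of the glue.
-/

noncomputable section

-- `Summit.<Summit>.<Problem>`: single-conjunct summit, the duplicate namespace segment is mandated.
set_option linter.dupNamespace false

namespace Summit.AnomalousDissipation.AnomalousDissipation.Cruxes.ResolvedDissipation.EnstrophyUiTransfer

open MeasureTheory Filter Topology Set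
open scoped ENNReal InnerProductSpace RealInnerProductSpace
open Literature.Analysis.FunctionSpaces Literature.Analysis.FluidPDE
open Summit.AnomalousDissipation.AnomalousDissipation.Theses.MomentParity
open Summit.AnomalousDissipation.AnomalousDissipation.Theorems.CubicParityLoud.Negative (T3 R3 H3 L2T3)
open Summit.AnomalousDissipation.AnomalousDissipation.Theorems.QuarticGate.Negative
  (IsLevel IsBandTest polyGrad IsPolyStationary)

/-! ## S1 — THE HARD STUB (conjecture-grade): trajectory uniform integrability of the Galerkin enstrophy -/

/-- **S1 · `stub_trajectoryUI` (TUI) — `N`-uniform time-integrability of the enstrophy along Galerkin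
trajectories from `V`-bounded data over one fixed window.** For every smooth divergence-free mean-zero force `f`,
`ν > 0` and radius `R` there is a window `T > 0` such that for every enstrophy level `G < ∞` of the data and every
`ε > 0` one threshold `M < ∞` works for EVERY Galerkin order `N`: every zero-mean Galerkin mode `a` of order `N`
with `‖a‖₂² ≤ R²` and `‖∇a‖² ≤ G` spends at most `ε` of time-integrated enstrophy above `M` during `[0, T]`:
`∫₀ᵀ ‖∇S^N_t a‖² · 1{‖∇S^N_t a‖² > M} dt ≤ ε` (`S^N_t = Torus.galerkinFlow ν f N t`).
STATUS: conjecture-grade. It is a finite-dimensional, finite-time, measure-free form of the energy-equality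
problem — precisely its "no concentration in TIME" half: by Vitali's theorem it is IMPLIED (modulo the classical
Galerkin → Leray–Hopf compactness for `L²`-convergent data) by the energy EQUALITY on `[0, T]` of every Leray–Hopf
solution of NS(ν, f) arising as a limit of Galerkin solutions from `V`-bounded, `L²`-convergent data (strong
`L²H¹` convergence makes the Galerkin enstrophies converge in `L¹(0,T)`, hence uniformly integrable), so it is
implied by the Leray–Hopf energy equality between positive times (LHEE, S5 of line `lh-energy-equality-bracket`) plus
local strong well-posedness, and by global regularity of NS(ν, f); conversely its failure produces a Galerkin-limit
Leray–Hopf solution from `V`-data whose energy defect is concentrated in time at unbounded enstrophy levels. (The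
complementary "no escape in WAVENUMBER at bounded enstrophy" half is, for stationary laws, a theorem: the FGT weighted
`H²` bound inside the Reduction.) It implies the crux (glue below + Reduction p90097). It WEAKENS the strategist's GEB
(`sup_{t≤T} ‖∇S^N_t a‖² ≤ M(G, T)`, STRATEGY-CENSUS S⁺1) from a sup to a truncated time integral — exactly what
`L¹(0,T)`-convergence of Galerkin enstrophies delivers, whereas a uniform sup bound is not known to follow even from
regularity. WHY IT MIGHT FAIL: a sequence of Galerkin solutions from `H¹`-bounded data dissipating a fixed amount of
energy at ever higher enstrophy levels within time `T` (anomalous dissipation at fixed `ν` for spectral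
approximations) — its subsequential limit would be a Leray–Hopf solution from `V`-data violating the energy equality.
[cite: FMRT2001, Ch. IV (1.31); Tao arXiv:0710.1604 Thm 1.4; RobinsonRodrigoSadowski2016, Thm. 4.4] -/
theorem stub_trajectoryUI :
    ∀ f : UnitAddTorus (Fin 3) → EuclideanSpace ℝ (Fin 3),
      Torus.IsSmooth f → Torus.IsDivFree f → Torus.HasZeroMean f →
      ∀ ν : ℝ, 0 < ν → ∀ R : ℝ, ∃ T : ℝ, 0 < T ∧
        ∀ G : ℝ≥0∞, G ≠ ⊤ → ∀ ε : ℝ≥0∞, 0 < ε → ∃ M : ℝ≥0∞, M ≠ ⊤ ∧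
          ∀ (N : ℕ) (a : UnitAddTorus (Fin 3) → EuclideanSpace ℝ (Fin 3)),
            IsGalerkinMode N a → Torus.HasZeroMean a → ∫ x, ‖a x‖ ^ 2 ≤ R ^ 2 →
            Torus.eGradNormSq a ≤ G →
            ∫⁻ t in Set.Ioo 0 T, (Set.Ioi M).indicator id
                (Torus.eGradNormSq (Torus.galerkinFlow ν f N t a)) ≤ ε := by
  sorry

/-! ## S2a — zero mean is preserved by the Galerkin semiflow (size S) -/

/-- **S2a · `stub_zeroMean_galerkinFlow`.** For `ν ≥ 0`, a smooth zero-mean force `f` and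
a zero-mean Galerkin mode `a` of order `N`, every slice `Torus.galerkinFlow ν f N t a`, `t ≥ 0`, has zero mean.
WHY TRUE: the orbit is `realTrigPoly (freqBall N) (φ_t â|_N)‾` (`IsGalerkinMode.galerkinFlow_eq`), whose mean is
the `k = 0` coefficient; along the Galerkin ODE `(galerkinRHS c)_0 = leraySym 0 (ĝ 0 − convectionCoeff c c 0)`
(`galerkinField`, `freqNormSq 0 = 0`), `ĝ 0 = f̂(0) = 0` (zero-mean force) and
`convectionCoeff S c c 0 = Σ_m 2πi (c_{−m}·m) c_m = 0` by transversality of the phase space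
(`(−m)·c_{−m} = 0`); so the `0`-th coefficient has zero derivative on `[0, ∞)` and keeps its initial value
`â(0) = 0`. [folklore; ConstantinFoias1988 Ch. 8 (8.5)] -/
theorem stub_zeroMean_galerkinFlow :
    ∀ (ν : ℝ), 0 ≤ ν → ∀ (f : T3 → R3), Torus.IsSmooth f → Torus.HasZeroMean f →
    ∀ (N : ℕ) (a : T3 → R3), IsGalerkinMode N a → Torus.HasZeroMean a →
    ∀ t : ℝ, 0 ≤ t → Torus.HasZeroMean (Torus.galerkinFlow ν f N t a) :=
  Summit.AnomalousDissipation.AnomalousDissipation.Theorems.MomentParityResolvedDissipation.ZeroMeanFlow.stub_zeroMean_galerkinFlow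

/-! ## S2 — pathwise time-integrated enstrophy bound (size M) -/

/-- **S2 · `stub_pathwiseDissipation` — the energy identity bounds the time-integrated enstrophy of a Galerkin
orbit, uniformly in `N`.** For `ν > 0`, a smooth force `f`, a Galerkin mode `a` of order `N` whose orbit stays
zero-mean (S2a), and `T ≥ 0`: `∫₀ᵀ ‖∇S^N_t a‖² dt ≤ (‖a‖₂² + T‖f‖₂²/(4π²ν))/ν`.
WHY TRUE: the exact energy identity of the orbit (`IsGalerkinMode.galerkinFlow_clauses`, last clause, `s = 0`):
`½‖S_T a‖² + ν∫₀ᵀ‖∇S_t a‖² = ½‖a‖² + ∫₀ᵀ∫⟪f, S_t a⟫`; Cauchy–Schwarz and the Poincaré inequality for zero-mean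
Galerkin modes (`4π²‖v‖₂² ≤ ‖∇v‖²`: Parseval `integral_norm_sq_realTrigPoly`-type identity, `v̂(0) = 0`, `|k|² ≥ 1`)
give `∫⟪f, S_t a⟫ ≤ ‖f‖₂‖∇S_t a‖/(2π) ≤ (ν/2)‖∇S_t a‖² + ‖f‖₂²/(8π²ν)`; absorb. (The lintegral is finite: the
integrand is bounded on `[0, T]`.) `0 < ν` load-bearing. [cite: RobinsonRodrigoSadowski2016, Thm. 4.4 Step 2 (4.6)–(4.8)] -/
theorem stub_pathwiseDissipation :
    ∀ (ν : ℝ), 0 < ν → ∀ (f : T3 → R3), Torus.IsSmooth f →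
    ∀ (N : ℕ) (a : T3 → R3), IsGalerkinMode N a →
      (∀ t : ℝ, 0 ≤ t → Torus.HasZeroMean (Torus.galerkinFlow ν f N t a)) →
    ∀ T : ℝ, 0 ≤ T →
      ∫⁻ t in Set.Ioo 0 T, Torus.eGradNormSq (Torus.galerkinFlow ν f N t a) ≤
        ENNReal.ofReal ((∫ x, ‖a x‖ ^ 2 + T * (∫ x, ‖f x‖ ^ 2) / (4 * Real.pi ^ 2 * ν)) / ν) :=
  Summit.AnomalousDissipation.AnomalousDissipation.Theorems.MomentParityResolvedDissipation.PathwiseDissipation.stub_pathwiseDissipation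

/-! ## S3 — invariance averaging for admissible laws (size M) -/

/-- **S3 · `stub_invarianceAveraging` — an admissible law is the time average of its own Galerkin evolution.**
Let `μ` be an admissible law of the crux at `(ν, f, N, R)` (`0 < ν`, `f` smooth zero-mean; probability, level-`N`
carried, supported in `‖u‖ ≤ R`, stationary at every polynomial degree), `Θ u = û|_{freqBall N}` the coefficient
map and `φ_t = galerkinCoeffFlow ν f̂|_{freqBall N} t` the Galerkin semiflow on coefficients. Then for every
window `T > 0` and every measurable `F ≥ 0` on the coefficient space,
`∫ F(Θ u) dμ = T⁻¹ ∫ (∫₀ᵀ F(φ_t(Θ u)) dt) dμ`.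
WHY TRUE: `Θ_* μ` is `φ_t`-invariant for every `t ≥ 0` (`MomentParityResolvedDissipation.admissible_coeffLaw_invariant`),
so `∫ F∘Θ dμ = ∫ F∘φ_t∘Θ dμ` (`lintegral_map`, `φ_t` a.e.-measurable: continuous on the closed phase space
`galerkinSubspace`, which contains every `Θ u`, `MomentParity.fourierRestrict_coe_mem_galerkinSubspace`); integrate
`dt` over `(0, T)` and swap (Tonelli, joint continuity `continuousOn_galerkinCoeffFlow` on `[0,∞) × phase space`).
[cite: FMRT2001, Ch. IV App. B.1; folklore (Krylov–Bogoliubov averaging)] -/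
theorem stub_invarianceAveraging :
    ∀ (ν : ℝ), 0 < ν → ∀ (f : T3 → R3), Torus.IsSmooth f → Torus.HasZeroMean f →
    ∀ (N : ℕ) (R : ℝ) (μ : Measure H3), IsProbabilityMeasure μ →
      (∀ᵐ u ∂μ, IsLevel N u) → (∀ᵐ u ∂μ, ‖u‖ ≤ R) → (∀ d : ℕ, IsPolyStationary ν f N d μ) →
    ∀ T : ℝ, 0 < T →
    ∀ F : (↥(Torus.freqBall (d := Fin 3) N) → EuclideanSpace ℂ (Fin 3)) → ℝ≥0∞, Measurable F →
      ∫⁻ u, F (fourierRestrict (Torus.freqBall N) (u.1 : T3 → R3)) ∂μ =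
        (ENNReal.ofReal T)⁻¹ *
          ∫⁻ u, (∫⁻ t in Set.Ioo 0 T,
            F (galerkinCoeffFlow ν (fourierRestrict (Torus.freqBall N) f) t
              (fourierRestrict (Torus.freqBall N) (u.1 : T3 → R3)))) ∂μ :=
  Summit.AnomalousDissipation.AnomalousDissipation.Theorems.MomentParityResolvedDissipation.InvarianceAveraging.stub_invarianceAveraging

/-! ## S4 — level-`N` states in the coefficient picture (size S/M) -/

/-- **S4 · `stub_levelCoeff` — a level-`N` state, read through its Fourier coefficients, is a zero-mean Galerkin
mode of order `N` with the same `L²` norm and the same enstrophy.** For `u : H` with `IsLevel N u` put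
`c = û|_{freqBall N}` and `a = realTrigPoly (freqBall N) c̄` (`= P_N u`, `realTrigPoly_coeffExt_fourierRestrict`).
Then `a` is a Galerkin mode of order `N` (`isGalerkinMode_realTrigPoly_coeffExt` +
`MomentParity.fourierRestrict_coe_mem_galerkinSubspace`, true for every `u`), `a` has zero mean (`û(0) = 0` from the
level clause), `∫‖a‖² = ‖u‖²` (`P_N u = u` a.e., `CubicParityLoud.Negative.fourierTruncate_ae_eq_of_isLevel`, and
`‖u‖² = ∫‖u‖²` on `H`), and `‖∇a‖² = ‖∇u‖²` (`eGradNormSq_fourierTruncate_of_isLevel`). [folklore] -/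
theorem stub_levelCoeff :
    ∀ (N : ℕ) (u : H3), IsLevel N u →
      IsGalerkinMode N (Torus.realTrigPoly (Torus.freqBall N)
        (Torus.coeffExt (Torus.freqBall N) (fourierRestrict (Torus.freqBall N) (u.1 : T3 → R3)))) ∧
      Torus.HasZeroMean (Torus.realTrigPoly (Torus.freqBall N)
        (Torus.coeffExt (Torus.freqBall N) (fourierRestrict (Torus.freqBall N) (u.1 : T3 → R3)))) ∧
      ∫ x, ‖Torus.realTrigPoly (Torus.freqBall N)
        (Torus.coeffExt (Torus.freqBall N) (fourierRestrict (Torus.freqBall N) (u.1 : T3 → R3))) x‖ ^ 2 =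
          ‖u‖ ^ 2 ∧
      Torus.eGradNormSq (Torus.realTrigPoly (Torus.freqBall N)
        (Torus.coeffExt (Torus.freqBall N) (fourierRestrict (Torus.freqBall N) (u.1 : T3 → R3)))) =
          Torus.eGradNormSq (u.1 : T3 → R3) :=
  Summit.AnomalousDissipation.AnomalousDissipation.Theorems.MomentParityResolvedDissipation.LevelCoeff.stub_levelCoeff

/-! ## Glue (lead) — TUI ⟹ U at `(f, ν, R)` -/

/-- **`uniformIntegrability_of_trajectoryUI` — trajectory-UI implies the `N`-uniform uniform integrability of the
enstrophy over admissible laws** (the hypothesis of the landed Reduction, verbatim), at fixed `(f, ν, R)`.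
Proof: with `T` from S1, given `η` pick `G` with `T⁻¹ · (R² + T‖f‖²/(4π²ν))/ν · ‖f‖R/(νG) ≤ η/2` and `M` from S1 at
`(G, ηT/2)`; S3 with `F = 1{Z>M}Z` in coefficients, split at `Z(Θu) ≤ G` (S1 via S4's dictionary and the
conjugacy `galerkinFlow_realTrigPoly`) / `> G` (S2 + Markov with the budget `ensembleEnstrophy_le_budget`). -/
theorem uniformIntegrability_of_trajectoryUI
    (f : T3 → R3) (hf : Torus.IsSmooth f) (h0 : Torus.HasZeroMean f)
    (ν : ℝ) (hν : 0 < ν) (R : ℝ)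
    (hTUI : ∃ T : ℝ, 0 < T ∧
        ∀ G : ℝ≥0∞, G ≠ ⊤ → ∀ ε : ℝ≥0∞, 0 < ε → ∃ M : ℝ≥0∞, M ≠ ⊤ ∧
          ∀ (N : ℕ) (a : UnitAddTorus (Fin 3) → EuclideanSpace ℝ (Fin 3)),
            IsGalerkinMode N a → Torus.HasZeroMean a → ∫ x, ‖a x‖ ^ 2 ≤ R ^ 2 →
            Torus.eGradNormSq a ≤ G →
            ∫⁻ t in Set.Ioo 0 T, (Set.Ioi M).indicator id
                (Torus.eGradNormSq (Torus.galerkinFlow ν f N t a)) ≤ ε) :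
    ∀ ε : ℝ≥0∞, 0 < ε → ∃ M : ℝ≥0∞, M ≠ ⊤ ∧
        ∀ (N : ℕ) (μ : Measure (Torus.energySpace (Fin 3))), IsProbabilityMeasure μ →
          (∀ᵐ u ∂μ, IsLevel N u) → (∀ᵐ u ∂μ, ‖u‖ ≤ R) → (∀ d : ℕ, IsPolyStationary ν f N d μ) →
          ∫⁻ u in {u : Torus.energySpace (Fin 3) |
              M < Torus.eGradNormSq (u.1 : UnitAddTorus (Fin 3) → EuclideanSpace ℝ (Fin 3))},
            Torus.eGradNormSq (u.1 : UnitAddTorus (Fin 3) → EuclideanSpace ℝ (Fin 3)) ∂μ ≤ ε :=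
  -- the landed glue, fed with THIS skeleton's stubs (= the tree theorem `TrajectoryUI.uniformIntegrability_of_trajectoryUI`)
  Summit.AnomalousDissipation.AnomalousDissipation.Theorems.MomentParityResolvedDissipation.TrajectoryUI.uniformIntegrability_of_trajectoryUI_of_stubs
    stub_zeroMean_galerkinFlow stub_pathwiseDissipation stub_invarianceAveraging stub_levelCoeff f hf h0 ν hν R hTUI

/-! ## Calibration of S1 (lead c6): LHEE ⟹ TUI — registered calibration stubs S6–S9 and the assembly

The two conjecture-grade leaves of the crux become COMPARABLE by a tree theorem: the Leray–Hopf energy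
equality between positive times (LHEE, S5 of line `lh-energy-equality-bracket`, hypothesis verbatim as in
`LhBracket.resolvedAt_of_lerayHopfEnergyEquality`) implies S1 (TUI). Proof (Vitali): a violating sequence of
Galerkin orbits from good data has unbounded orders (S7), forms a Hopf–Galerkin FAMILY
(`isHopfGalerkinFamily_galerkinFlow`), converges coefficientwise to a limit field along a subsequence
(`exists_limitField`), strongly in `L²` at time `0` (S8: the data are `H¹`-bounded) and at a.e. time
(`exists_strictMono_ae_tendsto_eLpNorm`); the limit is a global Leray–Hopf solution (`isGlobalLerayHopf_limit`),
LHEE gives its energy equality between two strong times `s₁ < T(G) ≤ 1 < s₂`, so the Galerkin dissipation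
integrals over `(s₁, s₂)` CONVERGE to that of the limit (S9); with the slicewise Fatou inequality this is
`L¹(s₁, s₂)`-convergence of the enstrophies, hence uniform integrability (S6); on `(0, s₁]` the local bound
`galerkin_enstrophy_local_bound` (c5) kills the integrand. -/

/-- **S6 · `stub_vitaliUI` (LANDED p143417, `VitaliUI.stub_vitaliUI`) — convergence of integrals + Fatou from below ⟹ uniform integrability (size M).**
On a finite measure space let `g j, h ≥ 0` be a.e.-measurable with `h ≤ liminf g j` a.e., all integrals finite and
`∫ g j → ∫ h`. Then the `g j` are uniformly integrable in the level form: for every `δ > 0` one finite threshold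
`C` gives `∫ g j · 1{g j > C} ≤ δ` for EVERY `j`. WHY TRUE: `(h − g j)⁺ → 0` a.e. (Fatou hypothesis) and is
dominated by `h`, so `∫ (h − g j)⁺ → 0`; `∫ (g j − h)⁺ = ∫ g j − ∫ h + ∫ (h − g j)⁺ → 0`; hence `g j → h` in `L¹`,
and an `L¹`-convergent sequence is uniformly integrable (Vitali; Mathlib `unifIntegrable_of_tendsto_Lp`,
`UniformIntegrable.spec'`), the finitely many leading terms by dominated convergence. [folklore; Bogachev,
Measure Theory I, Thm 4.5.4] -/
theorem stub_vitaliUI {α : Type*} [MeasurableSpace α] (μ : Measure α) [IsFiniteMeasure μ]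
    (g : ℕ → α → ℝ≥0∞) (h : α → ℝ≥0∞) (hg : ∀ j, AEMeasurable (g j) μ) (hh : AEMeasurable h μ)
    (hle : ∀ᵐ x ∂μ, h x ≤ Filter.liminf (fun j => g j x) Filter.atTop)
    (hfin : ∫⁻ x, h x ∂μ ≠ ⊤) (hgfin : ∀ j, ∫⁻ x, g j x ∂μ ≠ ⊤)
    (hconv : Filter.Tendsto (fun j => ∫⁻ x, g j x ∂μ) Filter.atTop (𝓝 (∫⁻ x, h x ∂μ))) :
    ∀ δ : ℝ≥0∞, 0 < δ → ∃ C : ℝ≥0∞, C ≠ ⊤ ∧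
      ∀ j, ∫⁻ x, (Set.Ioi C).indicator id (g j x) ∂μ ≤ δ :=
  Summit.AnomalousDissipation.AnomalousDissipation.Theorems.MomentParityResolvedDissipation.VitaliUI.stub_vitaliUI
    μ g h hg hh hle hfin hgfin hconv

/-- **S7 · `stub_boundedOrders` (LANDED p143377, `BoundedOrders.stub_boundedOrders`) — at bounded Galerkin order the enstrophy of orbits from the `L²`-ball is
bounded on a window (size S/M).** For `ν ≥ 0`, a smooth steady force `f`, a radius `R`, an order bound `N₀`
and a window `T ≥ 0` there is a finite `M` with `‖∇S^N_t a‖² ≤ M` for all `N ≤ N₀`, all Galerkin modes `a`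
of order `N` with `∫‖a‖² ≤ R²` and all `t ∈ [0, T]`. WHY TRUE: the exact energy identity of the orbit
(`IsGalerkinMode.galerkinFlow_clauses`, last clause) and `∫⟪f, S_t a⟫ ≤ ½∫‖f‖² + ½∫‖S_t a‖²` give, by
Grönwall on `[0, T]`, `∫‖S^N_t a‖² ≤ (R² + T∫‖f‖²)e^T`; the slices are Galerkin modes of order `N ≤ N₀`
(`isGalerkinMode_galerkinFlow`), so `‖∇S_t a‖² = 4π² Σ_{|k|≤N} |k|²|ĉ_k|² ≤ 4π²N₀² ∫‖S_t a‖²`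
(`eGradNormSq_eq_sum_of_band_limited`, `freqNormSq ≤ N²` on `freqBall N`, Parseval). [folklore] -/
theorem stub_boundedOrders (ν : ℝ) (hν : 0 ≤ ν) (f : T3 → R3) (hf : Torus.IsSmooth f) (R : ℝ) (N₀ : ℕ)
    (T : ℝ) (hT : 0 ≤ T) :
    ∃ M : ℝ≥0∞, M ≠ ⊤ ∧ ∀ (N : ℕ), N ≤ N₀ → ∀ (a : T3 → R3), IsGalerkinMode N a →
      ∫ x, ‖a x‖ ^ 2 ≤ R ^ 2 →
      ∀ t ∈ Set.Icc (0 : ℝ) T, Torus.eGradNormSq (Torus.galerkinFlow ν f N t a) ≤ M :=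
  Summit.AnomalousDissipation.AnomalousDissipation.Theorems.MomentParityResolvedDissipation.BoundedOrders.stub_boundedOrders
    ν hν f hf R N₀ T hT

/-- **S8 · `stub_initialStrong` (LANDED p143361, `InitialStrong.stub_initialStrong`) — Rellich on the Fourier side (size S/M).** If `L²` fields `v j` with
UNIFORMLY bounded spectral enstrophy `‖∇v j‖² ≤ G < ∞` converge coefficientwise to an `L²` field `w`, then
`v j → w` strongly in `L²`. WHY TRUE: `‖∇w‖² ≤ liminf ‖∇v j‖² ≤ G`
(`eGradNormSq_le_liminf_of_tendsto_mFourierCoeff`); split at frequency `K`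
(`Torus.lintegral_enorm_sub_sq_le_sum_add`): the finitely many low modes converge, the tail is
`≤ (2/(4π²K²))·2G`, small for `K` large; `eLpNorm_two` is the square root of that `lintegral`. [folklore;
RobinsonRodrigoSadowski2016 Thm 4.11 (proof)] -/
theorem stub_initialStrong (G : ℝ≥0∞) (hG : G ≠ ⊤) (v : ℕ → T3 → R3) (w : T3 → R3)
    (hv : ∀ j, MemLp (v j) 2 volume) (hw : MemLp w 2 volume)
    (hZ : ∀ j, Torus.eGradNormSq (v j) ≤ G)
    (hcv : ∀ k, Filter.Tendsto (fun j => UnitAddTorus.mFourierCoeff (EuclideanSpace.complexify ∘ v j) k)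
      Filter.atTop (𝓝 (UnitAddTorus.mFourierCoeff (EuclideanSpace.complexify ∘ w) k))) :
    Filter.Tendsto (fun j => eLpNorm (v j - w) 2 volume) Filter.atTop (𝓝 0) :=
  Summit.AnomalousDissipation.AnomalousDissipation.Theorems.MomentParityResolvedDissipation.InitialStrong.stub_initialStrong
    G hG v w hv hw hZ hcv

/-- **S9 · `stub_energyPassage` (LANDED p143328, `EnergyPassage.stub_energyPassage`) — the Galerkin dissipation integrals converge between two strong times when the
limit conserves energy there (size M).** Let `U` be a Hopf–Galerkin family for the steady smooth force `f`
(`ν > 0`) converging coefficientwise at every time to `u` (with `L²` slices, measurable lift), STRONGLY in `L²`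
at the two times `0 ≤ s₁ ≤ s₂`, and suppose the limit satisfies the energy EQUALITY on `[s₁, s₂]`. Then
`∫_{s₁}^{s₂} ‖∇U n‖² → ∫_{s₁}^{s₂} ‖∇u‖²`. WHY TRUE: the exact energy identity of the family on `[s₁, s₂]`
(`IsHopfGalerkinFamily.energy_eq`), convergence of the kinetic energies at `s₁, s₂`
(`Torus.tendsto_kineticEnergy_of_tendsto_eLpNorm`) and of the work (`IsHopfGalerkinFamily.tendsto_work` with
`T = s₂ + 1`; force bookkeeping `aestronglyMeasurable_stLift_const`, `lintegral_force_lt_top`) identify the limit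
of `ν∫‖∇U n‖²` with the right-hand side of the limit's energy equality; `ν > 0`; all lintegrals are finite
(`lintegral_eGradNormSq_lt_top`, `lintegral_eGradNormSq_limit_lt_top`, monotonicity in the set), so `toReal`
convergence is `ℝ≥0∞` convergence. [folklore; RobinsonRodrigoSadowski2016 Thm 4.6 (proof)] -/
theorem stub_energyPassage (ν : ℝ) (hν : 0 < ν) (f : T3 → R3) (hf : Torus.IsSmooth f)
    (u₀ : T3 → R3) (hu₀ : MemLp u₀ 2 volume) (N : ℕ → ℕ) (U : ℕ → ℝ → T3 → R3) (u : ℝ → T3 → R3)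
    (hF : IsHopfGalerkinFamily ν (fun _ => f) u₀ N (fun _ _ => f) U)
    (hum : AEStronglyMeasurable (Torus.stLift u) (volume.restrict (Set.Ioi (0 : ℝ) ×ˢ Set.univ)))
    (hu : ∀ t, 0 ≤ t → MemLp (u t) 2 volume)
    (hc : ∀ t, 0 ≤ t → ∀ k, Filter.Tendsto
      (fun n => UnitAddTorus.mFourierCoeff (EuclideanSpace.complexify ∘ U n t) k) Filter.atTop
      (𝓝 (UnitAddTorus.mFourierCoeff (EuclideanSpace.complexify ∘ u t) k)))
    (s₁ s₂ : ℝ) (hs₁ : 0 ≤ s₁) (hs₁₂ : s₁ ≤ s₂)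
    (h₁ : Filter.Tendsto (fun n => eLpNorm (U n s₁ - u s₁) 2 volume) Filter.atTop (𝓝 0))
    (h₂ : Filter.Tendsto (fun n => eLpNorm (U n s₂ - u s₂) 2 volume) Filter.atTop (𝓝 0))
    (hEE : Torus.kineticEnergy (u s₂) + ν * (∫⁻ τ in Set.Ioo s₁ s₂, Torus.eGradNormSq (u τ)).toReal =
        Torus.kineticEnergy (u s₁) + ∫ τ in s₁..s₂, ∫ x, ⟪f x, u τ x⟫_ℝ) :
    Filter.Tendsto (fun n => ∫⁻ τ in Set.Ioo s₁ s₂, Torus.eGradNormSq (U n τ)) Filter.atTop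
      (𝓝 (∫⁻ τ in Set.Ioo s₁ s₂, Torus.eGradNormSq (u τ))) :=
  Summit.AnomalousDissipation.AnomalousDissipation.Theorems.MomentParityResolvedDissipation.EnergyPassage.stub_energyPassage
    ν hν f hf u₀ hu₀ N U u hF hum hu hc s₁ s₂ hs₁ hs₁₂ h₁ h₂ hEE

/-! ## v8 (lead c7) — calibration stubs for **TUI ⟹ GEE₀ (a.e. pairs)**: the leaf made canonical

Programme: along a Hopf–Galerkin family with the exact steady force and mean-zero data, TUI (S1) at the restart radius
forbids time-concentration of the enstrophy at high levels; the `N`-uniform PATHWISE FGT bound (S10) forbids escape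
in wavenumber at bounded levels; the low modes pass to the limit (S11); members restart as Galerkin orbits (S12).
Hence the dissipation integrals CONVERGE on TUI windows and the coefficientwise limit satisfies the energy EQUALITY
between a.e. pairs of positive times (lead's stub S14). Conversely the a.e./mean-zero form of GEE still gives TUI
(S13 = c6's proof under the weaker hypothesis). Net: GEE ⟹ GEE₀ᵃᵉ ⟺ TUI ⟹ U ⟺ RD. -/

/-- **S10 · `stub_pathwiseFGT` (LANDED p148927, `PathwiseFGT.stub_pathwiseFGT`) — the `N`-uniform pathwise Foias–Guillopé–Temam bound along Galerkin orbits
(size M).** For `ν > 0`, a smooth mean-zero force `f`, a radius `R` and a window `T ≥ 0` there is ONE finite `C`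
such that for EVERY order `N` and every mean-zero Galerkin mode `a` of order `N` with `∫‖a‖² ≤ R²`,
`∫₀ᵀ ‖ΔS^N_t a‖² / (1 + ‖∇S^N_t a‖²)² dt ≤ C`. WHY TRUE: along the coefficient orbit
(`isGalerkinODESolution_galerkinCoeffFlow`, `IsGalerkinMode.galerkinFlow_eq`) the enstrophy `Z` has right
derivative `2(∫⟪Δu,(u·∇)u⟫ − ν‖Δu‖² − ∫⟪P_N f,Δu⟫)` (`hasDerivWithinAt_enstrophy`); the landed generator bound
`TrajectoryUILocalWindow.galerkin_generator_enstrophy_le` APPLIED WITH VISCOSITY ν/2 reads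
`2(X − (ν/2)P − Y) ≤ 8A Z³ + 2B` (`A = 27C₀⁴/(16ν³)`, `B = ‖f‖₂²/ν`, `P = ‖Δu‖²`), i.e. `Z' ≤ −νP + 8A Z³ + 2B`
with the dissipative term KEPT; then `W = −(1+Z)⁻¹` has `W' = Z'/(1+Z)² ≤ −νP/(1+Z)² + 8A Z + 2B`, and integrating
(`image_le_of_deriv_right_le_deriv_boundary` on `W + ν∫P/(1+Z)² − 8A∫Z − 2Bt`, FTC for the continuous integrands)
gives `ν∫₀ᵀ P/(1+Z)² ≤ 1 + 8A∫₀ᵀ Z + 2BT`, where `ν∫₀ᵀ Z ≤ ∫‖a‖² + T‖f‖₂²/(4π²ν)` is the pathwise energy bound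
(`PathwiseDissipation.stub_pathwiseDissipation`); `Z`, `P` of the orbit are `toReal` of `Torus.eGradNormSq`,
`eLaplacianNormSq` (`toReal_eGradNormSq_coeffExt`, `toReal_eLaplacianNormSq_coeffExt`). The zero mode stays `0`
(`ZeroMeanFlow.stub_zeroMean_galerkinFlow`), as the sharp Agmon inequality needs. [cite: FoiasGuillopeTemam1981;
FMRTTurbulence2001, Ch. II App. A (A.55)–(A.60)] -/
theorem stub_pathwiseFGT (ν : ℝ) (hν : 0 < ν) (f : T3 → R3) (hf : Torus.IsSmooth f)
    (hf0 : Torus.HasZeroMean f) (R T : ℝ) (hT : 0 ≤ T) :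
    ∃ C : ℝ≥0∞, C ≠ ⊤ ∧ ∀ (N : ℕ) (a : T3 → R3), IsGalerkinMode N a → Torus.HasZeroMean a →
      ∫ x, ‖a x‖ ^ 2 ≤ R ^ 2 →
      ∫⁻ t in Set.Ioo 0 T, eLaplacianNormSq (Torus.galerkinFlow ν f N t a) /
          (1 + Torus.eGradNormSq (Torus.galerkinFlow ν f N t a)) ^ 2 ≤ C :=
  Summit.AnomalousDissipation.AnomalousDissipation.Theorems.MomentParityResolvedDissipation.PathwiseFGT.stub_pathwiseFGT ν hν f hf hf0 R T hT

/-- **S11 · `stub_lowModePassage` (LANDED p148587, `LowModePassage.stub_lowModePassage`) — the low-mode enstrophy integrals pass to the limit (size S/M).** If the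
fields `U n τ` (`τ ∈ [s, t]`, `0 ≤ s ≤ t`) have `∫‖U n τ‖² ≤ B`, measurable Fourier coefficients in time, and
converge coefficientwise at every time of `[s, t]` to `u τ`, then for every cutoff `K`
`∫ₛᵗ ‖∇P_K U n‖² → ∫ₛᵗ ‖∇P_K u‖²`. WHY TRUE: `‖∇P_K v‖² = 4π² Σ_{|k|≤K} |k|²‖v̂ k‖²` is a FINITE sum of
continuous functions of finitely many coefficients (`fourierTruncate_eq`, `eGradNormSq_realTrigPoly` /
`eGradNormSq_eq_sum_of_band_limited`, `mFourierCoeff_fourierTruncate`), so the integrands converge at every time and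
are measurable; they are dominated by the constant `4π²K²B` (`‖v̂ k‖² ≤ ∫‖v‖²`, Parseval/Bessel, cf.
`Converse.eGradNormSq_fourierTruncate_le_norm`), integrable on the finite interval; dominated convergence for
`lintegral` (`tendsto_lintegral_of_dominated_convergence`). [folklore] -/
theorem stub_lowModePassage (K : ℕ) (U : ℕ → ℝ → T3 → R3) (u : ℝ → T3 → R3) (s t : ℝ) (hs : 0 ≤ s)
    (hst : s ≤ t) (B : ℝ)
    (hU2 : ∀ n τ, s ≤ τ → τ ≤ t → MemLp (U n τ) 2 volume)
    (hB : ∀ n τ, s ≤ τ → τ ≤ t → ∫ x, ‖U n τ x‖ ^ 2 ≤ B)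
    (hmeas : ∀ n k, AEStronglyMeasurable
      (fun τ => UnitAddTorus.mFourierCoeff (EuclideanSpace.complexify ∘ U n τ) k) (volume.restrict (Set.Ioo s t)))
    (hcv : ∀ τ, s ≤ τ → τ ≤ t → ∀ k, Filter.Tendsto
      (fun n => UnitAddTorus.mFourierCoeff (EuclideanSpace.complexify ∘ U n τ) k) Filter.atTop
      (𝓝 (UnitAddTorus.mFourierCoeff (EuclideanSpace.complexify ∘ u τ) k))) :
    Filter.Tendsto (fun n => ∫⁻ τ in Set.Ioo s t, Torus.eGradNormSq (Torus.fourierTruncate K (U n τ)))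
      Filter.atTop (𝓝 (∫⁻ τ in Set.Ioo s t, Torus.eGradNormSq (Torus.fourierTruncate K (u τ)))) :=
  Summit.AnomalousDissipation.AnomalousDissipation.Theorems.MomentParityResolvedDissipation.LowModePassage.stub_lowModePassage K U u s t hs hst B hU2 hB hmeas hcv

/-- **S12 · `stub_restart` (LANDED p148957, `Restart.stub_restart`) — members of a Hopf–Galerkin family with the exact steady force restart as Galerkin
orbits (size S).** For `ν > 0`, a smooth mean-zero force `f` and a Hopf–Galerkin family `U` with force `F n = f`
and mean-zero data, every slice `U n s` (`s ≥ 0`) is a mean-zero Galerkin mode of order `N n`, the member IS the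
Galerkin orbit of that slice, `U n (τ + s) = S^{N n}_τ (U n s)` for `τ ≥ 0`, and set-`lintegral`s over the shifted
window are `lintegral`s along the orbit. WHY TRUE: the clauses of `IsHopfGalerkinFamily` at index `n` with `F n = f`
are verbatim those of `Torus.IsGalerkinTrajectory ν f (N n) (U n)` (`Torus.isGalerkinTrajectory_iff` / the
constructor), so `UniformGalerkinTrap.apply_add_eq_galerkinFlow_of_isGalerkinTrajectory` (uniqueness for the
Galerkin ODE) gives the orbit identity, in particular `U n s = S_s (U n 0)`, whence zero mean
(`ZeroMeanFlow.stub_zeroMean_galerkinFlow`); the last clause is translation invariance of Lebesgue measure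
(`lintegral_add_right_eq_self` on indicators of `Ioo`). [folklore] -/
theorem stub_restart (ν : ℝ) (hν : 0 < ν) (f : T3 → R3) (hf : Torus.IsSmooth f) (hf0 : Torus.HasZeroMean f)
    (u₀ : T3 → R3) (N : ℕ → ℕ) (U : ℕ → ℝ → T3 → R3)
    (hF : IsHopfGalerkinFamily ν (fun _ => f) u₀ N (fun _ _ => f) U) (hmean : ∀ n, Torus.HasZeroMean (U n 0))
    (n : ℕ) (s : ℝ) (hs : 0 ≤ s) :
    IsGalerkinMode (N n) (U n s) ∧ Torus.HasZeroMean (U n s) ∧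
      (∀ τ, 0 ≤ τ → U n (τ + s) = Torus.galerkinFlow ν f (N n) τ (U n s)) ∧
      ∀ (T : ℝ) (G : (T3 → R3) → ℝ≥0∞),
        ∫⁻ t in Set.Ioo s (s + T), G (U n t) = ∫⁻ τ in Set.Ioo 0 T, G (Torus.galerkinFlow ν f (N n) τ (U n s)) :=
  Summit.AnomalousDissipation.AnomalousDissipation.Theorems.MomentParityResolvedDissipation.Restart.stub_restart ν hν f hf hf0 u₀ N U hF hmean n s hs

/-- **S13 · `stub_trajectoryUIOfGalerkinEEae` (LANDED p149679, `TrajectoryUIOfGalerkinEEae.stub_trajectoryUIOfGalerkinEEae`) — GEE₀ᵃᵉ(ν, f) ⟹ TUI(f, ν, R) (size M; c6's assembly under the weaker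
leaf).** The energy equality is assumed only for coefficientwise limits of Hopf–Galerkin families of NS(ν, f) with the
exact steady force and MEAN-ZERO data converging strongly in `L²` at time `0`, and only between a.e. PAIRS of positive
times (`∀ᵐ t₀, ∀ᵐ t₁, 0 < t₀ ≤ t₁ → …`). WHY TRUE: the proof of
`TrajectoryUIOfGalerkinEE.trajectoryUIAt_of_galerkinLimitEnergyEquality` (lead c6) builds its family from Galerkin
orbits of mean-zero modes (`isHopfGalerkinFamily_galerkinFlow_of_isGalerkinMode`; zero mean of the data by
`Torus.galerkinFlow_zero`) and applies the energy equality at exactly one pair of STRONG times `s₁ ∈ (0, min(T_G,1))`,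
`s₂ ∈ (1, 2)` picked from a.e.-sets (`hpick`); intersecting those a.e.-sets with the two a.e.-sets of the hypothesis
(outer in `s₁`, inner in `s₂`) changes nothing else: S8 at `t = 0`, S9 energy passage, S6 Vitali-UI, c5's local bound
on `(0, s₁]`, S7 for bounded orders. [folklore; RobinsonRodrigoSadowski2016 Thm 4.6] -/
theorem stub_trajectoryUIOfGalerkinEEae (ν : ℝ) (hν : 0 < ν) (f : T3 → R3) (hf : Torus.IsSmooth f)
    (hf0 : Torus.HasZeroMean f)
    (hGEE : ∀ (u₀ : T3 → R3), MemLp u₀ 2 volume → ∀ (N : ℕ → ℕ) (U : ℕ → ℝ → T3 → R3) (u : ℝ → T3 → R3),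
      IsHopfGalerkinFamily ν (fun _ => f) u₀ N (fun _ _ => f) U →
      (∀ n, Torus.HasZeroMean (U n 0)) →
      AEStronglyMeasurable (Torus.stLift u) (volume.restrict (Set.Ioi (0 : ℝ) ×ˢ Set.univ)) →
      (∀ t, 0 ≤ t → MemLp (u t) 2 volume) →
      (∀ t, 0 ≤ t → ∀ k, Filter.Tendsto
        (fun n => UnitAddTorus.mFourierCoeff (EuclideanSpace.complexify ∘ U n t) k) Filter.atTop
        (𝓝 (UnitAddTorus.mFourierCoeff (EuclideanSpace.complexify ∘ u t) k))) →
      Filter.Tendsto (fun n => eLpNorm (U n 0 - u 0) 2 volume) Filter.atTop (𝓝 0) →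
      ∀ᵐ t₀ ∂(volume : Measure ℝ), ∀ᵐ t₁ ∂(volume : Measure ℝ), 0 < t₀ → t₀ ≤ t₁ →
        Torus.kineticEnergy (u t₁) + ν * (∫⁻ τ in Set.Ioo t₀ t₁, Torus.eGradNormSq (u τ)).toReal =
          Torus.kineticEnergy (u t₀) + ∫ τ in t₀..t₁, ∫ x, ⟪f x, u τ x⟫_ℝ)
    (R : ℝ) :
    ∃ T : ℝ, 0 < T ∧
      ∀ G : ℝ≥0∞, G ≠ ⊤ → ∀ ε : ℝ≥0∞, 0 < ε → ∃ M : ℝ≥0∞, M ≠ ⊤ ∧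
        ∀ (N : ℕ) (a : UnitAddTorus (Fin 3) → EuclideanSpace ℝ (Fin 3)),
          IsGalerkinMode N a → Torus.HasZeroMean a → ∫ x, ‖a x‖ ^ 2 ≤ R ^ 2 →
          Torus.eGradNormSq a ≤ G →
          ∫⁻ t in Set.Ioo 0 T, (Set.Ioi M).indicator id
              (Torus.eGradNormSq (Torus.galerkinFlow ν f N t a)) ≤ ε :=
  Summit.AnomalousDissipation.AnomalousDissipation.Theorems.MomentParityResolvedDissipation.TrajectoryUIOfGalerkinEEae.stub_trajectoryUIOfGalerkinEEae ν hν f hf hf0 hGEE R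

/-- **S14 · `stub_galerkinEEaeOfTrajectoryUI` (LEAD; LANDED p151234 + p151586, `GalerkinEEaeOfTUI.stub_galerkinEEaeOfTrajectoryUI`) — TUI(f, ν, ·) ⟹ GEE₀ᵃᵉ(ν, f).** If S1 holds at `(f, ν, R)` for
every radius `R`, then every coefficientwise limit `u` of a Hopf–Galerkin family of NS(ν, f) with the exact steady
force and mean-zero data (measurable lift, `L²` slices, strong `L²` convergence at time `0`) satisfies the energy
EQUALITY between a.e. pairs of positive times. WHY TRUE (c7): fix a horizon; along a subsequence the slices converge
strongly at a.e. time (`exists_strictMono_ae_tendsto_eLpNorm`) and `liminf_n ‖∇U n s‖² < ∞` at a.e. `s` (Fatou with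
`lintegral_eGradNormSq_le`); at such a RESTART time `s` a further subsequence has `‖∇U n s‖² ≤ G`, the members are the
Galerkin orbits of these mean-zero slices in the `L²`-ball of radius `R'` (S12, `integral_norm_sq_le`), so S1 at
`(f, ν, R')` gives `∫_s^{s+T₀} Z 1{Z>M} ≤ ε` uniformly, S10 gives `∫ 1{Z≤M} ‖ΔU n‖² ≤ (1+M)²C` uniformly, the
enstrophy above the cutoff `K` is `≤ ‖ΔU n‖²/(4π²(K²+1))` on good times
(`eGradNormSq_eq_fourierTruncate_add_tail`, `tailGradNormSq_mul_le_eLapNormSq`) and `≤ Z 1{Z>M}` on bad times, and the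
low modes converge (S11, `eGradNormSq_fourierTruncate_le`): `limsup_n ∫_s^t Z(U n) ≤ ∫_s^t Z(u)` for `t ≤ s + T₀`;
with Fatou (`eGradNormSq_le_liminf_of_tendsto_mFourierCoeff`) the dissipation integrals converge, and with the
energies at strong times (`tendsto_kineticEnergy_of_tendsto_eLpNorm`) and the work (`tendsto_work`) the exact
identities `energy_eq` pass to the limit; windows chain along strong restart times (a.e., hence dense). -/
theorem stub_galerkinEEaeOfTrajectoryUI (ν : ℝ) (hν : 0 < ν) (f : T3 → R3) (hf : Torus.IsSmooth f)
    (hdiv : Torus.IsDivFree f) (hf0 : Torus.HasZeroMean f)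
    (hTUI : ∀ R : ℝ, ∃ T : ℝ, 0 < T ∧
      ∀ G : ℝ≥0∞, G ≠ ⊤ → ∀ ε : ℝ≥0∞, 0 < ε → ∃ M : ℝ≥0∞, M ≠ ⊤ ∧
        ∀ (N : ℕ) (a : UnitAddTorus (Fin 3) → EuclideanSpace ℝ (Fin 3)),
          IsGalerkinMode N a → Torus.HasZeroMean a → ∫ x, ‖a x‖ ^ 2 ≤ R ^ 2 →
          Torus.eGradNormSq a ≤ G →
          ∫⁻ t in Set.Ioo 0 T, (Set.Ioi M).indicator id
              (Torus.eGradNormSq (Torus.galerkinFlow ν f N t a)) ≤ ε)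
    (u₀ : T3 → R3) (hu₀ : MemLp u₀ 2 volume) (N : ℕ → ℕ) (U : ℕ → ℝ → T3 → R3) (u : ℝ → T3 → R3)
    (hF : IsHopfGalerkinFamily ν (fun _ => f) u₀ N (fun _ _ => f) U)
    (hmean : ∀ n, Torus.HasZeroMean (U n 0))
    (hum : AEStronglyMeasurable (Torus.stLift u) (volume.restrict (Set.Ioi (0 : ℝ) ×ˢ Set.univ)))
    (hu : ∀ t, 0 ≤ t → MemLp (u t) 2 volume)
    (hcv : ∀ t, 0 ≤ t → ∀ k, Filter.Tendsto
      (fun n => UnitAddTorus.mFourierCoeff (EuclideanSpace.complexify ∘ U n t) k) Filter.atTop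
      (𝓝 (UnitAddTorus.mFourierCoeff (EuclideanSpace.complexify ∘ u t) k)))
    (h0 : Filter.Tendsto (fun n => eLpNorm (U n 0 - u 0) 2 volume) Filter.atTop (𝓝 0)) :
    ∀ᵐ t₀ ∂(volume : Measure ℝ), ∀ᵐ t₁ ∂(volume : Measure ℝ), 0 < t₀ → t₀ ≤ t₁ →
      Torus.kineticEnergy (u t₁) + ν * (∫⁻ τ in Set.Ioo t₀ t₁, Torus.eGradNormSq (u τ)).toReal =
        Torus.kineticEnergy (u t₀) + ∫ τ in t₀..t₁, ∫ x, ⟪f x, u τ x⟫_ℝ :=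
  Summit.AnomalousDissipation.AnomalousDissipation.Theorems.MomentParityResolvedDissipation.GalerkinEEaeOfTUI.stub_galerkinEEaeOfTrajectoryUI ν hν f hf hdiv hf0 hTUI u₀ hu₀ N U u hF hmean hum hu
    hcv h0


section Assembly

open Literature.Analysis.FunctionSpaces.Torus Literature.Analysis.FluidPDE.Torus UnitAddTorus
open Summit.AnomalousDissipation.AnomalousDissipation.Theorems.MomentParity

/-! ## Two bookkeeping lemmas -/

/-- **Galerkin orbits from Galerkin-MODE data of bounded energy form a Hopf–Galerkin family** (lead c6; the
tree's `isHopfGalerkinFamily_galerkinFlow`, which takes phase-space coefficient data, rewritten through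
`IsGalerkinMode.realTrigPoly_fourierRestrict` and Parseval `integral_norm_sq_realTrigPoly_coeffExt`). -/
theorem isHopfGalerkinFamily_galerkinFlow_of_isGalerkinMode {ν : ℝ} (hν : 0 ≤ ν) {f : T3 → R3}
    (hf : Torus.IsSmooth f) {N : ℕ → ℕ} (hN : Tendsto N atTop atTop) {a : ℕ → T3 → R3}
    (ha : ∀ j, IsGalerkinMode (N j) (a j)) {R : ℝ} (hR : ∀ j, ∫ x, ‖a j x‖ ^ 2 ≤ R ^ 2) :
    IsHopfGalerkinFamily ν (fun _ => f) (fun _ => EuclideanSpace.single (0 : Fin 3) R) N (fun _ _ => f)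
      (fun j t => Torus.galerkinFlow ν f (N j) t (a j)) := by
  have hc : ∀ j, fourierRestrict (freqBall (N j)) (a j) ∈ galerkinSubspace (freqBall (N j)) :=
    fun j => (ha j).fourierRestrict_mem
  have hR' : ∀ j, ∑ k ∈ freqBall (N j),
      ‖coeffExt (freqBall (N j)) (fourierRestrict (freqBall (N j)) (a j)) k‖ ^ 2 ≤ R ^ 2 := by
    intro j
    rw [← integral_norm_sq_realTrigPoly_coeffExt (hc j), (ha j).realTrigPoly_fourierRestrict]
    exact hR j
  have h := isHopfGalerkinFamily_galerkinFlow hν hf hN hc hR'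
  have hrw : (fun j t => Torus.galerkinFlow ν f (N j) t
      (realTrigPoly (freqBall (N j)) (coeffExt (freqBall (N j)) (fourierRestrict (freqBall (N j)) (a j))))) =
      fun j t => Torus.galerkinFlow ν f (N j) t (a j) := by
    funext j t
    rw [(ha j).realTrigPoly_fourierRestrict]
  rw [hrw] at h
  exact h

/-- An unbounded sequence of naturals has a subsequence tending to infinity (lead c6; from
`Filter.extraction_forall_of_frequently`). -/
theorem exists_strictMono_tendsto_of_forall_exists_lt {N : ℕ → ℕ} (h : ∀ K : ℕ, ∃ m, K < N m) :
    ∃ ψ : ℕ → ℕ, StrictMono ψ ∧ Tendsto (N ∘ ψ) atTop atTop := by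
  have hfreq : ∀ K : ℕ, ∃ᶠ m in atTop, K ≤ N m := by
    intro K
    rw [Filter.frequently_atTop]
    intro b
    obtain ⟨m, hm⟩ := h (K + ∑ i ∈ Finset.range b, N i)
    refine ⟨m, ?_, by omega⟩
    by_contra hmb
    push Not at hmb
    have hle : N m ≤ ∑ i ∈ Finset.range b, N i :=
      Finset.single_le_sum (fun i _ => Nat.zero_le (N i)) (Finset.mem_range.2 hmb)
    omega
  obtain ⟨ψ, hψ, hψN⟩ := Filter.extraction_forall_of_frequently hfreq
  exact ⟨ψ, hψ, tendsto_atTop_mono hψN tendsto_id⟩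

/-- **LHEE(ν, f) ⟹ TUI(f, ν, R)** — the lead's assembly (c6). The Leray–Hopf energy equality between positive
times for the global Leray–Hopf solutions of NS(ν, f) (hypothesis verbatim as in
`LhBracket.resolvedAt_of_lerayHopfEnergyEquality`) implies trajectory uniform integrability of the Galerkin
enstrophy at `(f, ν, R)` with the window `T = 1` (any window works). See the section docstring for the proof.
[folklore argument; RobinsonRodrigoSadowski2016 Thm 4.6; FMRT2001 Ch. IV (1.31)] -/
theorem trajectoryUIAt_of_lerayHopfEnergyEquality {ν : ℝ} (hν : 0 < ν) {f : T3 → R3}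
    (hf : Torus.IsSmooth f) (hf0 : Torus.HasZeroMean f)
    (hLHEE : ∀ (u₀ : T3 → R3) (u : ℝ → T3 → R3), Torus.IsGlobalLerayHopf ν (fun _ => f) u₀ u →
      ∀ (t₀ t₁ : ℝ), 0 < t₀ → t₀ ≤ t₁ →
        Torus.kineticEnergy (u t₁) + ν * (∫⁻ τ in Set.Ioo t₀ t₁, Torus.eGradNormSq (u τ)).toReal =
          Torus.kineticEnergy (u t₀) + ∫ τ in t₀..t₁, ∫ x, ⟪f x, u τ x⟫_ℝ)
    (R : ℝ) :
    ∃ T : ℝ, 0 < T ∧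
      ∀ G : ℝ≥0∞, G ≠ ⊤ → ∀ ε : ℝ≥0∞, 0 < ε → ∃ M : ℝ≥0∞, M ≠ ⊤ ∧
        ∀ (N : ℕ) (a : UnitAddTorus (Fin 3) → EuclideanSpace ℝ (Fin 3)),
          IsGalerkinMode N a → Torus.HasZeroMean a → ∫ x, ‖a x‖ ^ 2 ≤ R ^ 2 →
          Torus.eGradNormSq a ≤ G →
          ∫⁻ t in Set.Ioo 0 T, (Set.Ioi M).indicator id
              (Torus.eGradNormSq (Torus.galerkinFlow ν f N t a)) ≤ ε := by
  refine ⟨1, one_pos, fun G hG ε hε => ?_⟩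
  by_contra H
  push Not at H
  -- violators at every natural threshold `m`
  choose Nf af hmode hmean hball hens hviol using fun m : ℕ => H (m : ℝ≥0∞) (ENNReal.natCast_ne_top m)
  -- the `N`-uniform local enstrophy bound (lead c5): `Z ≤ L` on `[0, TG]` along every violator
  obtain ⟨TG, hTG, hloc⟩ :=
    Summit.AnomalousDissipation.AnomalousDissipation.Theorems.MomentParityResolvedDissipation.TrajectoryUILocalWindow.galerkin_enstrophy_local_bound
      hν hf hf0 (G := G.toReal) ENNReal.toReal_nonneg
  have hGof : ENNReal.ofReal G.toReal = G := ENNReal.ofReal_toReal hG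
  set L : ℝ≥0∞ := ENNReal.ofReal (2 * G.toReal + 1)
  have hlocm : ∀ m, ∀ t ∈ Icc (0 : ℝ) TG,
      Torus.eGradNormSq (Torus.galerkinFlow ν f (Nf m) t (af m)) ≤ L := fun m t ht =>
    hloc (Nf m) (af m) (hmode m) (hmean m) (by rw [hGof]; exact hens m) t ht
  by_cases hbdd : ∃ N₀, ∀ m, Nf m ≤ N₀
  · -- bounded orders: S7 makes the integrand vanish at a large threshold
    obtain ⟨N₀, hN₀⟩ := hbdd
    obtain ⟨M₀, hM₀, hbound⟩ := stub_boundedOrders ν hν.le f hf R N₀ 1 zero_le_one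
    obtain ⟨m, hm⟩ := ENNReal.exists_nat_gt hM₀
    have hzero : ∫⁻ t in Ioo (0 : ℝ) 1, (Ioi (m : ℝ≥0∞)).indicator id
        (Torus.eGradNormSq (Torus.galerkinFlow ν f (Nf m) t (af m))) = 0 := by
      refine setLIntegral_eq_zero measurableSet_Ioo fun t ht => ?_
      have hle : Torus.eGradNormSq (Torus.galerkinFlow ν f (Nf m) t (af m)) ≤ (m : ℝ≥0∞) :=
        (hbound (Nf m) (hN₀ m) (af m) (hmode m) (hball m) t ⟨ht.1.le, ht.2.le⟩).trans hm.le
      exact indicator_of_notMem (fun hgt : _ < _ => absurd hle (not_le.2 hgt)) id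
    have hv := hviol m
    rw [hzero] at hv
    exact absurd hv (not_lt.2 bot_le)
  · -- unbounded orders: pass to a subsequence with `N → ∞`
    push Not at hbdd
    obtain ⟨ψ, hψ, hNψ⟩ := exists_strictMono_tendsto_of_forall_exists_lt hbdd
    set N : ℕ → ℕ := Nf ∘ ψ
    set a : ℕ → T3 → R3 := af ∘ ψ
    set U : ℕ → ℝ → T3 → R3 := fun j t => Torus.galerkinFlow ν f (N j) t (a j)
    have hF : IsHopfGalerkinFamily ν (fun _ => f) (fun _ => EuclideanSpace.single (0 : Fin 3) R) N
        (fun _ _ => f) U :=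
      isHopfGalerkinFamily_galerkinFlow_of_isGalerkinMode hν.le hf hNψ (fun j => hmode (ψ j))
        fun j => hball (ψ j)
    have hu₀ : MemLp (fun _ : T3 => EuclideanSpace.single (0 : Fin 3) R) 2 volume := memLp_const _
    have hfm := Literature.Analysis.FluidPDE.aestronglyMeasurable_stLift_const hf
      (volume.restrict (Ioi (0 : ℝ) ×ˢ univ))
    have hf₂ : ∀ T : ℝ, 0 < T → ∫⁻ _ in Ioo (0 : ℝ) T, ∫⁻ x, ‖f x‖ₑ ^ 2 < ⊤ := fun T _ =>
      lintegral_force_lt_top hf T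
    -- the limit field along `φ₁`
    obtain ⟨φ₁, hφ₁, u, hum, hu2, hcv⟩ := hF.exists_limitField hν.le hu₀ hfm hf₂
    have hF₁ := hF.comp_strictMono hφ₁
    -- strong `L²` convergence at a.e. time of `(0, 2)` along `φ₂`
    obtain ⟨φ₂, hφ₂, hae⟩ :=
      hF₁.exists_strictMono_ae_tendsto_eLpNorm hν hu₀ hfm hf₂ hum hu2 hcv (T := 2) two_pos
    set Φ : ℕ → ℕ := φ₁ ∘ φ₂
    have hF₂ : IsHopfGalerkinFamily ν (fun _ => f) (fun _ => EuclideanSpace.single (0 : Fin 3) R)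
        (N ∘ Φ) (fun _ _ => f) (U ∘ Φ) := hF₁.comp_strictMono hφ₂
    have hcv₂ : ∀ t, 0 ≤ t → ∀ k, Tendsto
        (fun j => mFourierCoeff (EuclideanSpace.complexify ∘ (U ∘ Φ) j t) k) atTop
        (𝓝 (mFourierCoeff (EuclideanSpace.complexify ∘ u t) k)) :=
      fun t ht k => (hcv t ht k).comp hφ₂.tendsto_atTop
    -- two strong times `s₁ ∈ (0, min TG 1)` and `s₂ ∈ (1, 2)`
    set τ : ℝ := min TG 1
    have hτpos : 0 < τ := lt_min hTG one_pos
    have hτ1 : τ ≤ 1 := min_le_right _ _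
    have hτG : τ ≤ TG := min_le_left _ _
    have hpick : ∀ α β : ℝ, 0 ≤ α → α < β → β ≤ 2 → ∃ s,
        Tendsto (fun j => eLpNorm ((U ∘ φ₁) (φ₂ j) s - u s) 2 volume) atTop (𝓝 0) ∧ s ∈ Ioo α β := by
      intro α β hα hαβ hβ
      have hsub : Ioo α β ⊆ Ioo 0 2 := Ioo_subset_Ioo hα hβ
      have hae' := ae_restrict_of_ae_restrict_of_subset hsub hae
      have hne : NeBot (ae (volume.restrict (Ioo α β))) := by
        rw [ae_neBot, Ne, Measure.restrict_eq_zero, Real.volume_Ioo, ENNReal.ofReal_eq_zero, not_le]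
        linarith
      exact (hae'.and (ae_restrict_mem measurableSet_Ioo)).exists
    obtain ⟨s₁, hs₁conv, hs₁mem⟩ := hpick 0 τ le_rfl hτpos (by linarith)
    obtain ⟨s₂, hs₂conv, hs₂mem⟩ := hpick 1 2 zero_le_one one_lt_two le_rfl
    have hs₁pos : 0 < s₁ := hs₁mem.1
    have hs₁₂ : s₁ < s₂ := by linarith [hs₁mem.2, hs₂mem.1]
    -- strong convergence at time `0` (S8) and the Leray–Hopf limit
    have h0 : Tendsto (fun j => eLpNorm ((U ∘ Φ) j 0 - u 0) 2 volume) atTop (𝓝 0) := by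
      refine stub_initialStrong G hG (fun j => (U ∘ Φ) j 0) (u 0) (fun j => hF₂.memLp_slice j le_rfl)
        (hu2 0 le_rfl) (fun j => ?_) (hcv₂ 0 le_rfl)
      show Torus.eGradNormSq (Torus.galerkinFlow ν f (N (Φ j)) 0 (a (Φ j))) ≤ G
      rw [Torus.galerkinFlow_zero]
      exact hens (ψ (Φ j))
    have hLH : Torus.IsGlobalLerayHopf ν (fun _ => f) (u 0) u :=
      hF₂.isGlobalLerayHopf_limit hν hu₀ hfm hf₂ hum hu2 hcv₂ h0
    -- energy equality of the limit on `[s₁, s₂]` (LHEE) and the energy passage (S9)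
    have hEE := hLHEE (u 0) u hLH s₁ s₂ hs₁pos hs₁₂.le
    have hconvZ := stub_energyPassage ν hν f hf _ hu₀ (N ∘ Φ) (U ∘ Φ) u hF₂ hum hu2 hcv₂ s₁ s₂
      hs₁pos.le hs₁₂.le hs₁conv hs₂conv hEE
    -- uniform integrability on `(s₁, s₂)` (S6)
    set μ : Measure ℝ := volume.restrict (Ioo s₁ s₂)
    have hsub2 : Ioo s₁ s₂ ⊆ Ioo 0 2 := Ioo_subset_Ioo hs₁pos.le hs₂mem.2.le
    have hg : ∀ j, AEMeasurable (fun t => Torus.eGradNormSq ((U ∘ Φ) j t)) μ := fun j =>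
      (hF₂.aemeasurable_eGradNormSq j 2).mono_measure (Measure.restrict_mono hsub2 le_rfl)
    have hh : AEMeasurable (fun t => Torus.eGradNormSq (u t)) μ := by
      have hcoef : ∀ k, AEStronglyMeasurable
          (fun t => mFourierCoeff (EuclideanSpace.complexify ∘ u t) k) (volume.restrict (Ioi 0)) := by
        intro k
        refine aestronglyMeasurable_of_tendsto_ae atTop
          (fun j => hF₂.aestronglyMeasurable_mFourierCoeff j k) ?_
        filter_upwards [ae_restrict_mem measurableSet_Ioi] with t ht
        exact hcv₂ t (le_of_lt ht) k
      exact (Torus.aemeasurable_eGradNormSq_of_coeff hcoef).mono_measure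
        (Measure.restrict_mono (Ioo_subset_Ioi_self.trans (Ioi_subset_Ioi hs₁pos.le)) le_rfl)
    have hle : ∀ᵐ t ∂μ, Torus.eGradNormSq (u t) ≤
        liminf (fun j => Torus.eGradNormSq ((U ∘ Φ) j t)) atTop := by
      filter_upwards [ae_restrict_mem measurableSet_Ioo] with t ht
      exact eGradNormSq_le_liminf_of_tendsto_mFourierCoeff hcv₂ (hs₁pos.trans ht.1).le
    have hfin : ∫⁻ t, Torus.eGradNormSq (u t) ∂μ ≠ ⊤ :=
      ((lintegral_mono_set hsub2).trans_lt
        (hF₂.lintegral_eGradNormSq_limit_lt_top hν hu₀ hfm hf₂ hcv₂ two_pos)).ne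
    have hgfin : ∀ j, ∫⁻ t, Torus.eGradNormSq ((U ∘ Φ) j t) ∂μ ≠ ⊤ := fun j =>
      ((lintegral_mono_set hsub2).trans_lt (hF₂.lintegral_eGradNormSq_lt_top j 2)).ne
    obtain ⟨C, hC, hUI⟩ := stub_vitaliUI μ (fun j t => Torus.eGradNormSq ((U ∘ Φ) j t))
      (fun t => Torus.eGradNormSq (u t)) hg hh hle hfin hgfin hconvZ ε hε
    -- the index: threshold above `max C L`
    have hC'top : max C L ≠ ⊤ := max_ne_top hC ENNReal.ofReal_ne_top
    obtain ⟨j, hj⟩ := ENNReal.exists_nat_gt hC'top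
    have hjm : ((j : ℕ) : ℝ≥0∞) ≤ ((ψ (Φ j) : ℕ) : ℝ≥0∞) := by
      exact_mod_cast (hψ.comp (hφ₁.comp hφ₂)).id_le j
    have hthr : max C L ≤ ((ψ (Φ j) : ℕ) : ℝ≥0∞) := hj.le.trans hjm
    have hCm : C ≤ ((ψ (Φ j) : ℕ) : ℝ≥0∞) := (le_max_left _ _).trans hthr
    have hLm : L ≤ ((ψ (Φ j) : ℕ) : ℝ≥0∞) := (le_max_right _ _).trans hthr
    -- the violation at the original index `m = ψ (Φ j)` is contradicted
    have hv := hviol (ψ (Φ j))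
    have hcover : Ioo (0 : ℝ) 1 ⊆ Ioc 0 s₁ ∪ Ioo s₁ s₂ := fun t ht =>
      (le_or_gt t s₁).elim (fun h => Or.inl ⟨ht.1, h⟩) fun h => Or.inr ⟨h, ht.2.trans hs₂mem.1⟩
    have hpiece₁ : ∫⁻ t in Ioc (0 : ℝ) s₁, (Ioi ((ψ (Φ j) : ℕ) : ℝ≥0∞)).indicator id
        (Torus.eGradNormSq (Torus.galerkinFlow ν f (Nf (ψ (Φ j))) t (af (ψ (Φ j))))) = 0 := by
      refine setLIntegral_eq_zero measurableSet_Ioc fun t ht => ?_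
      have hle' : Torus.eGradNormSq (Torus.galerkinFlow ν f (Nf (ψ (Φ j))) t (af (ψ (Φ j)))) ≤
          ((ψ (Φ j) : ℕ) : ℝ≥0∞) :=
        (hlocm (ψ (Φ j)) t ⟨ht.1.le, ht.2.trans (hs₁mem.2.le.trans hτG)⟩).trans hLm
      exact indicator_of_notMem (fun hgt : _ < _ => absurd hle' (not_le.2 hgt)) id
    have hpiece₂ : ∫⁻ t in Ioo s₁ s₂, (Ioi ((ψ (Φ j) : ℕ) : ℝ≥0∞)).indicator id
        (Torus.eGradNormSq (Torus.galerkinFlow ν f (Nf (ψ (Φ j))) t (af (ψ (Φ j))))) ≤ ε := by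
      refine le_trans (lintegral_mono fun t => ?_) (hUI j)
      exact indicator_le_indicator_of_subset (Ioi_subset_Ioi hCm) (fun _ => zero_le) _
    have hbound : ∫⁻ t in Ioo (0 : ℝ) 1, (Ioi ((ψ (Φ j) : ℕ) : ℝ≥0∞)).indicator id
        (Torus.eGradNormSq (Torus.galerkinFlow ν f (Nf (ψ (Φ j))) t (af (ψ (Φ j))))) ≤ ε :=
      calc ∫⁻ t in Ioo (0 : ℝ) 1, (Ioi ((ψ (Φ j) : ℕ) : ℝ≥0∞)).indicator id
            (Torus.eGradNormSq (Torus.galerkinFlow ν f (Nf (ψ (Φ j))) t (af (ψ (Φ j)))))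
          ≤ ∫⁻ t in Ioc (0 : ℝ) s₁ ∪ Ioo s₁ s₂, (Ioi ((ψ (Φ j) : ℕ) : ℝ≥0∞)).indicator id
              (Torus.eGradNormSq (Torus.galerkinFlow ν f (Nf (ψ (Φ j))) t (af (ψ (Φ j))))) :=
            lintegral_mono_set hcover
        _ ≤ (∫⁻ t in Ioc (0 : ℝ) s₁, (Ioi ((ψ (Φ j) : ℕ) : ℝ≥0∞)).indicator id
              (Torus.eGradNormSq (Torus.galerkinFlow ν f (Nf (ψ (Φ j))) t (af (ψ (Φ j)))))) +
            ∫⁻ t in Ioo s₁ s₂, (Ioi ((ψ (Φ j) : ℕ) : ℝ≥0∞)).indicator id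
              (Torus.eGradNormSq (Torus.galerkinFlow ν f (Nf (ψ (Φ j))) t (af (ψ (Φ j))))) :=
            lintegral_union_le _ _ _
        _ ≤ 0 + ε := add_le_add hpiece₁.le hpiece₂
        _ = ε := zero_add ε
    exact absurd hv (not_lt.2 hbound)


end Assembly

/-- **LHEE ⟹ TUI (global form)**: the conjecture-grade stub S5 of line `lh-energy-equality-bracket` (verbatim
the hypothesis of `LhBracket.resolvedDissipation_of_lerayHopfEnergyEquality`) implies S1 `stub_trajectoryUI`
(verbatim). With the landed `TrajectoryUI.resolvedDissipation_of_trajectoryUI` this re-derives the bracket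
`LHEE ⟹ ResolvedDissipation` through the Galerkin-intrinsic leaf: LHEE ⟹ TUI ⟹ U ⟹ RD. -/
theorem trajectoryUI_of_lerayHopfEnergyEquality
    (hLHEE : ∀ (ν : ℝ), 0 < ν → ∀ (f : UnitAddTorus (Fin 3) → EuclideanSpace ℝ (Fin 3)),
      Torus.IsSmooth f → Torus.IsDivFree f → Torus.HasZeroMean f →
    ∀ (u₀ : UnitAddTorus (Fin 3) → EuclideanSpace ℝ (Fin 3))
      (u : ℝ → UnitAddTorus (Fin 3) → EuclideanSpace ℝ (Fin 3)),
      Torus.IsGlobalLerayHopf ν (fun _ => f) u₀ u →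
    ∀ (t₀ t₁ : ℝ), 0 < t₀ → t₀ ≤ t₁ →
      Torus.kineticEnergy (u t₁) + ν * (∫⁻ τ in Set.Ioo t₀ t₁, Torus.eGradNormSq (u τ)).toReal =
        Torus.kineticEnergy (u t₀) + ∫ τ in t₀..t₁, ∫ x, ⟪f x, u τ x⟫_ℝ) :
    ∀ f : UnitAddTorus (Fin 3) → EuclideanSpace ℝ (Fin 3),
      Torus.IsSmooth f → Torus.IsDivFree f → Torus.HasZeroMean f →
      ∀ ν : ℝ, 0 < ν → ∀ R : ℝ, ∃ T : ℝ, 0 < T ∧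
        ∀ G : ℝ≥0∞, G ≠ ⊤ → ∀ ε : ℝ≥0∞, 0 < ε → ∃ M : ℝ≥0∞, M ≠ ⊤ ∧
          ∀ (N : ℕ) (a : UnitAddTorus (Fin 3) → EuclideanSpace ℝ (Fin 3)),
            IsGalerkinMode N a → Torus.HasZeroMean a → ∫ x, ‖a x‖ ^ 2 ≤ R ^ 2 →
            Torus.eGradNormSq a ≤ G →
            ∫⁻ t in Set.Ioo 0 T, (Set.Ioi M).indicator id
                (Torus.eGradNormSq (Torus.galerkinFlow ν f N t a)) ≤ ε :=
  fun f hf hdiv hf0 ν hν R =>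
    trajectoryUIAt_of_lerayHopfEnergyEquality hν hf hf0 (hLHEE ν hν f hf hdiv hf0) R

/-! ## GEE ⟹ TUI and GEE ⟹ RD (the weaker leaf; LANDED p145184, `TrajectoryUIOfGalerkinEE.stub_trajectoryUIOfGalerkinEE`)
GEE(ν, f) = the energy equality between positive times for coefficientwise limits of Hopf–Galerkin FAMILIES of NS(ν, f)
with strongly `L²`-convergent data; LHEE ⟹ GEE ⟹ S1 and GEE ⟹ `ResolvedDissipation` are tree theorems
(`galerkinLimitEnergyEquality_of_lerayHopfEnergyEquality`, `trajectoryUI_of_galerkinLimitEnergyEquality`,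
`resolvedDissipation_of_galerkinLimitEnergyEquality` in `Theorems/MomentParityResolvedDissipationTrajectoryUIOfGalerkinEE.lean`);
not re-imported here only because the `lean check` farm lags behind the tree for the newest modules (v7a). -/

/-! ## v9 (lead c7): the leaf is canonical — TUI (S1, global form) ⟺ GEE₀ᵃᵉ
(`Theorems/MomentParityResolvedDissipationTrajectoryUIIffGalerkinEEae.lean`: `trajectoryUI_iff_galerkinEEae`,
`resolvedDissipation_of_galerkinEEae`, `galerkinEEae_of_galerkinLimitEnergyEquality`; not re-imported here only because the
`lean check` farm lags behind the tree for the newest modules). The two directions, composed from the landed S13/S14: -/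

/-- **TUI (S1) ⟹ GEE₀ᵃᵉ (global form)** — from the landed S14. -/
theorem galerkinEEae_of_trajectoryUI
    (hTUI : ∀ f : UnitAddTorus (Fin 3) → EuclideanSpace ℝ (Fin 3),
      Torus.IsSmooth f → Torus.IsDivFree f → Torus.HasZeroMean f →
      ∀ ν : ℝ, 0 < ν → ∀ R : ℝ, ∃ T : ℝ, 0 < T ∧
        ∀ G : ℝ≥0∞, G ≠ ⊤ → ∀ ε : ℝ≥0∞, 0 < ε → ∃ M : ℝ≥0∞, M ≠ ⊤ ∧
          ∀ (N : ℕ) (a : UnitAddTorus (Fin 3) → EuclideanSpace ℝ (Fin 3)),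
            IsGalerkinMode N a → Torus.HasZeroMean a → ∫ x, ‖a x‖ ^ 2 ≤ R ^ 2 →
            Torus.eGradNormSq a ≤ G →
            ∫⁻ t in Set.Ioo 0 T, (Set.Ioi M).indicator id
                (Torus.eGradNormSq (Torus.galerkinFlow ν f N t a)) ≤ ε) :
    ∀ (ν : ℝ), 0 < ν → ∀ (f : UnitAddTorus (Fin 3) → EuclideanSpace ℝ (Fin 3)),
      Torus.IsSmooth f → Torus.IsDivFree f → Torus.HasZeroMean f →
      ∀ (u₀ : UnitAddTorus (Fin 3) → EuclideanSpace ℝ (Fin 3)), MemLp u₀ 2 volume →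
      ∀ (N : ℕ → ℕ) (U : ℕ → ℝ → UnitAddTorus (Fin 3) → EuclideanSpace ℝ (Fin 3))
        (u : ℝ → UnitAddTorus (Fin 3) → EuclideanSpace ℝ (Fin 3)),
      IsHopfGalerkinFamily ν (fun _ => f) u₀ N (fun _ _ => f) U →
      (∀ n, Torus.HasZeroMean (U n 0)) →
      AEStronglyMeasurable (Torus.stLift u) (volume.restrict (Set.Ioi (0 : ℝ) ×ˢ Set.univ)) →
      (∀ t, 0 ≤ t → MemLp (u t) 2 volume) →
      (∀ t, 0 ≤ t → ∀ k, Filter.Tendsto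
        (fun n => UnitAddTorus.mFourierCoeff (EuclideanSpace.complexify ∘ U n t) k) Filter.atTop
        (𝓝 (UnitAddTorus.mFourierCoeff (EuclideanSpace.complexify ∘ u t) k))) →
      Filter.Tendsto (fun n => eLpNorm (U n 0 - u 0) 2 volume) Filter.atTop (𝓝 0) →
      ∀ᵐ t₀ ∂(volume : Measure ℝ), ∀ᵐ t₁ ∂(volume : Measure ℝ), 0 < t₀ → t₀ ≤ t₁ →
        Torus.kineticEnergy (u t₁) + ν * (∫⁻ τ in Set.Ioo t₀ t₁, Torus.eGradNormSq (u τ)).toReal =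
          Torus.kineticEnergy (u t₀) + ∫ τ in t₀..t₁, ∫ x, ⟪f x, u τ x⟫_ℝ :=
  fun ν hν f hf hdiv hf0 u₀ hu₀ N U u hF hmean hum hu hcv h0 =>
    stub_galerkinEEaeOfTrajectoryUI ν hν f hf hdiv hf0 (fun R => hTUI f hf hdiv hf0 ν hν R) u₀ hu₀ N U u hF hmean
      hum hu hcv h0

/-- **GEE₀ᵃᵉ ⟹ TUI (S1, global form)** — from the landed S13. -/
theorem trajectoryUI_of_galerkinEEae
    (hGEE : ∀ (ν : ℝ), 0 < ν → ∀ (f : UnitAddTorus (Fin 3) → EuclideanSpace ℝ (Fin 3)),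
      Torus.IsSmooth f → Torus.IsDivFree f → Torus.HasZeroMean f →
      ∀ (u₀ : UnitAddTorus (Fin 3) → EuclideanSpace ℝ (Fin 3)), MemLp u₀ 2 volume →
      ∀ (N : ℕ → ℕ) (U : ℕ → ℝ → UnitAddTorus (Fin 3) → EuclideanSpace ℝ (Fin 3))
        (u : ℝ → UnitAddTorus (Fin 3) → EuclideanSpace ℝ (Fin 3)),
      IsHopfGalerkinFamily ν (fun _ => f) u₀ N (fun _ _ => f) U →
      (∀ n, Torus.HasZeroMean (U n 0)) →
      AEStronglyMeasurable (Torus.stLift u) (volume.restrict (Set.Ioi (0 : ℝ) ×ˢ Set.univ)) →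
      (∀ t, 0 ≤ t → MemLp (u t) 2 volume) →
      (∀ t, 0 ≤ t → ∀ k, Filter.Tendsto
        (fun n => UnitAddTorus.mFourierCoeff (EuclideanSpace.complexify ∘ U n t) k) Filter.atTop
        (𝓝 (UnitAddTorus.mFourierCoeff (EuclideanSpace.complexify ∘ u t) k))) →
      Filter.Tendsto (fun n => eLpNorm (U n 0 - u 0) 2 volume) Filter.atTop (𝓝 0) →
      ∀ᵐ t₀ ∂(volume : Measure ℝ), ∀ᵐ t₁ ∂(volume : Measure ℝ), 0 < t₀ → t₀ ≤ t₁ →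
        Torus.kineticEnergy (u t₁) + ν * (∫⁻ τ in Set.Ioo t₀ t₁, Torus.eGradNormSq (u τ)).toReal =
          Torus.kineticEnergy (u t₀) + ∫ τ in t₀..t₁, ∫ x, ⟪f x, u τ x⟫_ℝ) :
    ∀ f : UnitAddTorus (Fin 3) → EuclideanSpace ℝ (Fin 3),
      Torus.IsSmooth f → Torus.IsDivFree f → Torus.HasZeroMean f →
      ∀ ν : ℝ, 0 < ν → ∀ R : ℝ, ∃ T : ℝ, 0 < T ∧
        ∀ G : ℝ≥0∞, G ≠ ⊤ → ∀ ε : ℝ≥0∞, 0 < ε → ∃ M : ℝ≥0∞, M ≠ ⊤ ∧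
          ∀ (N : ℕ) (a : UnitAddTorus (Fin 3) → EuclideanSpace ℝ (Fin 3)),
            IsGalerkinMode N a → Torus.HasZeroMean a → ∫ x, ‖a x‖ ^ 2 ≤ R ^ 2 →
            Torus.eGradNormSq a ≤ G →
            ∫⁻ t in Set.Ioo 0 T, (Set.Ioi M).indicator id
                (Torus.eGradNormSq (Torus.galerkinFlow ν f N t a)) ≤ ε :=
  fun f hf hdiv hf0 ν hν R => stub_trajectoryUIOfGalerkinEEae ν hν f hf hf0 (hGEE ν hν f hf hdiv hf0) R

/-! ## v10 (lead c8): the ENSEMBLE-currency leaf in Literature vocabulary — S15 `stub_resolvedOfSSSEnergyEq` (LANDED p154314,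
`Theorems/MomentParityResolvedDissipationStubResolvedOfSSSEnergyEq.lean`: + `resolvedDissipation_of_sssEnergyEq`, `resolvedDissipation_of_energy_eq_three`, `sssEnergyEq_two`)

The crux is certified equivalent to the mean energy EQUALITY of Galerkin-limit stationary statistical solutions in a
ball (MEE, `Equivalently.resolvedDissipation_iff_galerkinLimitEnergyEq`, lead c1). S15 states the sufficient condition
in the LITERATURE's own words: the tree's Literature statement `Torus.IsStationaryStatisticalSolution.energy_eq` — the
mean energy equation `ν ∫‖∇u‖² dμ = ∫ (f,u) dμ` of a stationary statistical solution, stated and PROVED for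
`Fintype.card d = 2` (`energy_eq_holds`, FMRT 2001 IV Thm 2.2 / App. B.1) and flagged in print as known in `d = 3` only
as the inequality (1.31) — taken verbatim at `d = 3` for the solutions carried by the ball `‖u‖ ≤ R`, implies the
conclusion of the crux at `(f, ν, R)`. It is a calibration stub (not in the cone of `ResolvedDissipation_of`): it makes
"3-D stationary statistical solutions satisfy the mean energy equality" (SSSEE₃) the fourth named conjecture-grade
leaf, the only one typed in existing Literature vocabulary, with SSSEE₃ ⟹ MEE ⟺ RD ⟺ U ⟸ TUI ⟺ GEE₀ᵃᵉ ⟸ GEE ⟸ LHEE. -/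

/-- **S15 · `stub_resolvedOfSSSEnergyEq` — mean energy equality of the stationary statistical solutions in a ball
⟹ the crux's conclusion at `(f, ν, R)`.** Fix `ν > 0`, `f ∈ L²` and `R`. If every stationary statistical solution
of NS(ν, f) on `T³` in the tree's sense (`Torus.IsStationaryStatisticalSolution`, FMRT IV Def. 1.3: probability on
`H`, finite mean enstrophy (1.29), Liouville equation (1.30), shell energy inequality (1.31)) that is carried by the
ball `‖u‖ ≤ R` satisfies the mean energy EQUALITY `ν ∫ ‖∇u‖² dμ = ∫ (u, f) dμ` (the `d = 3` twin of the Literature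
statement `IsStationaryStatisticalSolution.energy_eq`, a theorem for `d = 2`), then ONE schedule `κ` resolves the
mean enstrophy of every level-`N` admissible law in that ball. WHY TRUE: along any admissible sequence at levels
`N_i → ∞` the energy row bounds the mean enstrophies `N`-uniformly (`ensembleEnstrophy_le_of_isStationary`), so
K2a `TightExtraction.stub_tightExtraction` extracts a limit law in the ball (bounded-continuous and truncated-enstrophy
convergence, lsc portmanteau), K2b `LimitSSS.stub_limitIsStationarySolution` shows the limit IS a stationary
statistical solution (finite enstrophy included), the hypothesis gives its energy equality, and K2c
`Schedule.stub_scheduleOfLimitEnergyEq` turns "every admissible sequence has an energy-conserving limit" into a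
schedule. [cite: FMRTTurbulence2001, Ch. IV Def. 1.3, (1.31)–(1.33), Thm. 2.2; arXiv:1606.02174 §4 Rem. 4.1] -/
theorem stub_resolvedOfSSSEnergyEq :
    ∀ (ν : ℝ), 0 < ν → ∀ (f : UnitAddTorus (Fin 3) → EuclideanSpace ℝ (Fin 3)), MemLp f 2 volume →
    ∀ R : ℝ,
      (∀ μ : Measure (Torus.energySpace (Fin 3)), Torus.IsStationaryStatisticalSolution ν f μ →
          (∀ᵐ u ∂μ, ‖u‖ ≤ R) →
          ν * (Torus.ensembleEnstrophy μ).toReal = ∫ u, Torus.pairing u.1 f ∂μ) →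
      ∃ κ : ℕ → ℕ, ∀ (N : ℕ) (μ : Measure (Torus.energySpace (Fin 3))), IsProbabilityMeasure μ →
        (∀ᵐ u ∂μ, IsLevel N u) → (∀ᵐ u ∂μ, ‖u‖ ≤ R) → (∀ d : ℕ, IsPolyStationary ν f N d μ) →
        ∀ n : ℕ, ∫⁻ u, Torus.eGradNormSq (u.1 : UnitAddTorus (Fin 3) → EuclideanSpace ℝ (Fin 3)) ∂μ ≤
          (∫⁻ u, Torus.eGradNormSq (Torus.fourierTruncate (κ n)
            (u.1 : UnitAddTorus (Fin 3) → EuclideanSpace ℝ (Fin 3))) ∂μ) + ((n : ℝ≥0∞) + 1)⁻¹ :=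
  -- LANDED p154314 (lead c8)
  Summit.AnomalousDissipation.AnomalousDissipation.Theorems.MomentParityResolvedDissipation.SSSEnergyEq.stub_resolvedOfSSSEnergyEq

/- The global corollary `SSSEE₃ ⟹ ResolvedDissipation` (crux BY NAME from S15) lives in the stub's Theorems file
   (`…StubResolvedOfSSSEnergyEq.resolvedDissipation_of_sssEnergyEq`): a skeleton may contain only ONE theorem concluding the crux. -/

/-! ## S16–S19 (lead c10): the `NoMeanLeakage` bridge — the leaf is an EXISTING ledger item -/

section NoMeanLeakageBridge

open Function Metric UnitAddTorus
open Literature.Analysis.FunctionSpaces.Torus Literature.Analysis.FluidPDE.Torus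
open Summit.AnomalousDissipation.AnomalousDissipation.Theorems.MomentParity

/-- **S16 · `stub_noMeanLeakage` (conjecture-grade; IS the ledger item stmt-AnomalousDissipation-14265
`Correlation.NoMeanLeakage`, crux #8 of route Correlation, also wanted by route CriticalLayer).** For every `ν > 0`, every
smooth divergence-free mean-zero steady force `f` on `T³` and EVERY global Leray–Hopf solution `u` (any datum): the mean
work does not exceed the mean viscous dissipation, `⟨(f,u)⟩ ≤ ν⟨‖∇u‖²⟩` (limsup of Cesàro means). Implied by the Leray–Hopf
energy equality between positive times (telescoping, FMRT 2001 (12.38)–(12.39)); open for `d = 3` (FMRT 2001 p. 71, Ch. IV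
(1.31)); a single Leray–Hopf solution leaking energy at a positive MEAN rate refutes it. NOT proved here: it is where the
crux now parks (`blocked-on: stmt-AnomalousDissipation-14265`). [cite: FMRTTurbulence2001, p. 71, Ch. IV (1.31), (12.38)–(12.39)] -/
theorem stub_noMeanLeakage :
    Summit.AnomalousDissipation.AnomalousDissipation.Theses.Correlation.NoMeanLeakage := by
  sorry

/-- **S19 · `stub_genericLeakingPoint` — a generic leaking path (Birkhoff selection).** Let `Q` be a shift-invariant
probability law on `𝒦 = pathSpace R L` whose mean unit-window work exceeds `∫ dissMean ν K dQ` by a margin `η > 0` at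
every cutoff `K` (`ν > 0`). Then some point `x` of `supp Q` has Birkhoff limits `w` of the work functional (integer-window
means of `Σ'_k Re⟪𝓕f k, x̄(t,k)⟫`) and `g` of the full unit-viscosity dissipation functional
`G = (⨆_K ofReal dissMean 1 K)·toReal` along the shift, `G` is finite along the whole orbit of `x`, and `ν g < w`.
WHY TRUE: `ν∫G dQ ≤ ∫W dQ − η` (monotone convergence); Birkhoff's pointwise ergodic theorem (tree
`Literature.Dynamics.Ergodic.birkhoff_ergodic_theorem_holds`) for `W` and `G`; `∫(W* − νG*) dQ ≥ η > 0` charges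
`{νG* < W*}`; intersect with the conull sets. LANDED p160579 by lead c10 (`NoMeanLeakageBridge.stub_genericLeakingPoint`).
[cite: DajaniKalle2021, Thm 3.1.1] -/
theorem stub_genericLeakingPoint :
    ∀ (R : ℝ) (L : (Fin 3 → ℤ) → ℝ) (f : UnitAddTorus (Fin 3) → EuclideanSpace ℝ (Fin 3)),
      Torus.IsSmooth f → ∀ (ν η : ℝ), 0 < ν → 0 < η →
    ∀ (Q : Measure ↥(pathSpace R L)), IsProbabilityMeasure Q →
      Q.map (pathShiftOn R L (pathShift_mapsTo R L)) = Q →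
      (∀ K : ℕ, (∫ ω, dissMean ν K ω.1 ∂Q) + η ≤
        ∫ ω, (∫ t in (0 : ℝ)..1, ∑' k : Fin 3 → ℤ,
          (inner ℂ (mFourierCoeff (EuclideanSpace.complexify ∘ f) k) (pathExt ω.1 t k)).re) ∂Q) →
    ∃ x : ↥(pathSpace R L), x ∈ Q.support ∧ ∃ w g : ℝ,
      Tendsto (fun m : ℕ => (m : ℝ)⁻¹ * ∫ t in (0 : ℝ)..m, ∑' k : Fin 3 → ℤ,
        (inner ℂ (mFourierCoeff (EuclideanSpace.complexify ∘ f) k) (pathExt x.1 t k)).re) atTop (𝓝 w) ∧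
      Tendsto (fun m : ℕ => (m : ℝ)⁻¹ * ∑ i ∈ Finset.range m,
        (⨆ K : ℕ, ENNReal.ofReal (dissMean 1 K (pathShift^[i] x.1))).toReal) atTop (𝓝 g) ∧
      (∀ i : ℕ, (⨆ K : ℕ, ENNReal.ofReal (dissMean 1 K (pathShift^[i] x.1))) ≠ ⊤) ∧
      ν * g < w :=
  -- LANDED (lead c10)
  Summit.AnomalousDissipation.AnomalousDissipation.Theorems.MomentParityResolvedDissipation.NoMeanLeakageBridge.stub_genericLeakingPoint

/-- **S18 · `stub_meansOfRealisation` — long-time means of a field realising a generic path.** Let `u` realise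
`ω ∈ 𝒦 = pathSpace R L` after the shift `s ≥ 0` (`u t ∈ L²`, `𝓕(u t) = ω̄(s+t, ·)` for `t ≥ 0`), let the integer-window
means of the work integrand converge to `w`, the Birkhoff averages of `G` along the orbit converge to `g`, and `G` be finite
along the orbit. Then `longTimeAvgSup (∫⟪f, u ·⟫) = w` and `meanDissipation ν u ≤ ν g`. WHY TRUE: Parseval for the work,
integer windows → all windows → shifted windows; for the dissipation `∫⁻_{(0,T)} ‖∇u‖² ≤ Σ_{i<⌈s+T⌉} G(θⁱω)` (monotone
convergence in the cutoff, window inequality), `⌈s+T⌉/T → 1`, comparison principle for `limsup`. LANDED p159669 by lead c10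
(`NoMeanLeakageBridge.stub_meansOfRealisation`). [folklore; FMRTTurbulence2001 Ch. IV App. B; DoeringFoias2002 §2] -/
theorem stub_meansOfRealisation :
    ∀ (R : ℝ) (L : (Fin 3 → ℤ) → ℝ) (f : UnitAddTorus (Fin 3) → EuclideanSpace ℝ (Fin 3)),
      Torus.IsSmooth f → ∀ (ν : ℝ), 0 ≤ ν →
    ∀ (ω : ℚ × (Fin 3 → ℤ) → EuclideanSpace ℂ (Fin 3)), ω ∈ pathSpace R L →
    ∀ (s : ℝ), 0 ≤ s →
    ∀ (u : ℝ → UnitAddTorus (Fin 3) → EuclideanSpace ℝ (Fin 3)),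
      (∀ t : ℝ, 0 ≤ t → MemLp (u t) 2 volume ∧
        ∀ k : Fin 3 → ℤ, mFourierCoeff (EuclideanSpace.complexify ∘ u t) k = pathExt ω (s + t) k) →
    ∀ (w g : ℝ),
      Tendsto (fun m : ℕ => (m : ℝ)⁻¹ * ∫ t in (0 : ℝ)..m, ∑' k : Fin 3 → ℤ,
        (inner ℂ (mFourierCoeff (EuclideanSpace.complexify ∘ f) k) (pathExt ω t k)).re) atTop (𝓝 w) →
      Tendsto (fun m : ℕ => (m : ℝ)⁻¹ * ∑ i ∈ Finset.range m,
        (⨆ K : ℕ, ENNReal.ofReal (dissMean 1 K (pathShift^[i] ω))).toReal) atTop (𝓝 g) →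
      (∀ i : ℕ, (⨆ K : ℕ, ENNReal.ofReal (dissMean 1 K (pathShift^[i] ω))) ≠ ⊤) →
      longTimeAvgSup (fun t => ∫ y, ⟪f y, u t y⟫_ℝ) = w ∧ meanDissipation ν u ≤ ν * g :=
  -- LANDED (lead c10)
  Summit.AnomalousDissipation.AnomalousDissipation.Theorems.MomentParityResolvedDissipation.NoMeanLeakageBridge.stub_meansOfRealisation

/-- **S17 · `stub_resolvedOfNoMeanLeakage` — the bridge `Correlation.NoMeanLeakage ⟹ ResolvedDissipation`, here in its
per-`(f, ν, R)` form `resolvedAt_of_noMeanLeakage` (the registered global form `NoMeanLeakage → ResolvedDissipation` is the landed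
`NoMeanLeakageBridge.stub_resolvedOfNoMeanLeakage`, p160579; a skeleton carries only ONE theorem whose conclusion is the crux decl,
`ResolvedDissipation_of` below).** WHY TRUE: by contradiction at `(f, ν, R)` — kill shape ⟹ leaking sequence ⟹ level laws with
margin ⟹ limit law `Q` (landed S1/S2 of line `lh-energy-equality-bracket`) ⟹ S19 generic leaking support point ⟹ realisation by a
global Leray–Hopf solution (landed `stub_supportApprox`, `stub_realisation`) ⟹ S18 its long-time means leak ⟹ ¬NML(ν, f). LANDED
p160579 by lead c10. [folklore lift: FoiasRosaTemam2013 Thm 3.1; FMRTTurbulence2001 Ch. IV App. B] -/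
theorem stub_resolvedAtOfNoMeanLeakage {ν : ℝ} (hν : 0 < ν)
    {f : UnitAddTorus (Fin 3) → EuclideanSpace ℝ (Fin 3)} (hf : Torus.IsSmooth f) (hf0 : Torus.HasZeroMean f)
    (hNML : ∀ (u₀ : UnitAddTorus (Fin 3) → EuclideanSpace ℝ (Fin 3))
      (u : ℝ → UnitAddTorus (Fin 3) → EuclideanSpace ℝ (Fin 3)),
      Torus.IsGlobalLerayHopf ν (fun _ => f) u₀ u →
      longTimeAvgSup (fun t => ∫ x, ⟪f x, u t x⟫_ℝ) ≤ meanDissipation ν u)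
    (R : ℝ) :
    ∃ κ : ℕ → ℕ, ∀ (N : ℕ) (μ : Measure (Torus.energySpace (Fin 3))), IsProbabilityMeasure μ →
      (∀ᵐ u ∂μ, IsLevel N u) → (∀ᵐ u ∂μ, ‖u‖ ≤ R) →
      Summit.AnomalousDissipation.AnomalousDissipation.Theorems.ResolvedDissipation.Negative.IsStationary ν f N μ →
      ∀ n : ℕ, Summit.AnomalousDissipation.AnomalousDissipation.Theorems.ResolvedDissipation.Negative.IsResolved κ μ n :=
  -- LANDED p160579 (lead c10)
  Summit.AnomalousDissipation.AnomalousDissipation.Theorems.MomentParityResolvedDissipation.NoMeanLeakageBridge.resolvedAt_of_noMeanLeakage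
    hν hf hf0 hNML R

end NoMeanLeakageBridge

/-! ## The composition (kernel-checked, no `sorry` of its own; ONE `sorry` in its cone: S16 = item stmt-AnomalousDissipation-14265) -/

/-- **`ResolvedDissipation` from S16 + S17**: the bridge applied to the leaf (`ResolvedDissipation` unfolds to its clauses by
`ResolvedDissipation.Negative.resolvedDissipation_iff`). -/
theorem ResolvedDissipation_of : ResolvedDissipation := by
  rw [Summit.AnomalousDissipation.AnomalousDissipation.Theorems.ResolvedDissipation.Negative.resolvedDissipation_iff]
  intro f hf hdiv hf0 ν hν R
  exact stub_resolvedAtOfNoMeanLeakage hν hf hf0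
    (fun u₀ u hLH => stub_noMeanLeakage ν f u₀ u hν hf hdiv hf0 hLH) R

/-- The ALTERNATIVE composition through S1 (TUI), kept kernel-checked as an `example` (a skeleton carries only ONE
theorem concluding the crux): the landed Reduction (`UI ⟹ RD` at `(f, ν, R)`) fed with the glue and S1. -/
example : ResolvedDissipation := by
  intro f hf hdiv hzero ν hν R
  obtain ⟨κ, hκ⟩ :=
    Summit.AnomalousDissipation.AnomalousDissipation.Theorems.MomentParityResolvedDissipation.resolvedDissipation_of_uniformIntegrability
      f hf ν hν R (uniformIntegrability_of_trajectoryUI f hf hzero ν hν R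
        (stub_trajectoryUI f hf hdiv hzero ν hν R))
  refine ⟨κ, fun N μ hp hl hb hs n => hκ N μ hp hl hb ?_ n⟩
  intro d m g P hg _
  exact hs m g P hg

end Summit.AnomalousDissipation.AnomalousDissipation.Cruxes.ResolvedDissipation.EnstrophyUiTransfer

end
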